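import Literature.NumberTheory.LFunctions.SekatskiiBeltraminelliMerliniProofs
import Literature.NumberTheory.LFunctions.ZetaZeroReciprocalSum
import Literature.NumberTheory.LFunctions.FordZetaZeroRecipSqSum
import Literature.NumberTheory.LFunctions.AmorosoCyclotomicCriterion
import Mathlib.Analysis.Calculus.ParametricIntegral
import Mathlib.Analysis.Calculus.SmoothSeries
import Mathlib.MeasureTheory.Integral.IntegralEqImproper
import Mathlib.NumberTheory.LSeries.Deriv
import Mathlib.NumberTheory.LSeries.Dirichlet
import Mathlib.Analysis.SpecialFunctions.JapaneseBracket
import HarnessLib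

/-!
# RH-EQUIVALENT (PROVED AS AN EQUIVALENCE) · Volchkov's criterion `∫₀^∞ (1−12t²)/(1+4t²)³ ∫_{1/2}^∞ log|ζ(σ+it)| dσ dt = π(3−γ)/32 ⟺ RH` — discharge of `Volchkov1995_criterion`; nothing here bears on the truth of RH

Literature-typing tranche `rh-lit-broughan-2` (Broughan, *Equivalents of the Riemann Hypothesis*
Vol. 2, Ch. 8 "Integral Equations"; the volume is not held). This file DISCHARGES the named fact
`Literature.NumberTheory.LFunctions.Volchkov1995_criterion` of `VolchkovTypeIntegralCriteria.lean`
(V. V. Volchkov, *On an equality equivalent to the Riemann hypothesis*, Ukr. Mat. Zh. 47 (1995)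
422–423; statement as printed in He–Jejjala–Minic 2016 §2 (2.1)): no definition, no new fact.

## The road (a deviation from the printed proof, recorded as such)

Volchkov (and Sekatskii–Beltraminelli–Merlini 2012, §3.1, Thm. 5a) integrate `log ζ(z) g(z)` over
rectangles with left side on `Re z = 1/2` ("generalised Littlewood theorem"). The tree holds
instead the Poisson-mean identity WITH its zero sum (`sbm_hasSum`, from the boundary Jensen
formula of `BalazardSaiasYorProofs`): for `a > 0`, `1/2 ≤ σ < 1`,

  `(a/π)∫_ℝ log|ζ(σ+it)| dt/(a²+t²) = log ζ₁(a+σ) − log(a+1−σ) + Σ_{Re ρ>σ} m(ρ) log(|ρ−σ+a|/|ρ−σ−a|)`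

(`ζ₁(s) = (s−1)ζ(s)`), and for `σ > 1` the zero- and pole-free value `log ζ(a+σ)`
(`sbm_poisson_of_one_lt`). Volchkov's weight is a second `a`-derivative of the Poisson kernel:
`(1−12t²)/(1+4t²)³ = (1/16) ∂²_a [a/(a²+t²)]` at `a = 1/2`. Differentiating the identity twice in
`a` (dominated differentiation under the integral; term-wise differentiation of the zero series,
dominated by `Σ m(ρ)/(1+γ²) < ∞`) and integrating over `σ ∈ (1/2, ∞)` gives, UNCONDITIONALLY,

  `∫₀^∞ (1−12t²)/(1+4t²)³ ∫_{1/2}^∞ log|ζ(σ+it)| dσ dt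
      = (π/32)·(3 − γ + Σ_{Re ρ > 1/2} m(ρ)·Z(ρ))`,
  `Z(ρ) = β/|ρ|² + (1−β)/|1−ρ|² − 1/(1/4+γ²) < 0`   (`ρ = β+iγ`, `1/2 < β < 1`),

where `3 − γ` comes from `∫_1^∞ (log ζ₁)'' = 0 − (log ζ₁)'(1) = −γ` (Mathlib
`deriv_riemannZeta₁_one`) and `∫_{1/2}^∞ (1/2+|1−σ|)^{−2} dσ = 3`, and the exchange of the two
printed integrations rests on the joint integrability of `(1−12t²)/(1+4t²)³·log|ζ(σ+it)|`
(Poisson-mean bounds uniform in `σ`). Every off-line zero contributes a NEGATIVE amount, so the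
printed equality holds iff no zero has `Re ρ > 1/2`, i.e. iff RH.

RH-EQUIVALENT bookkeeping: a kernel equivalence "integral = value ⟺ RH"; neither side is asserted
and nothing here bears on the truth of RH.

## References

* [Volchkov1995] V. V. Volchkov, *On an equality equivalent to the Riemann hypothesis*, Ukr. Mat.
  Zh. 47 (1995) 422–423 (Ukr. Math. J. 47, 491–493) — the criterion (not held; statement as
  printed in HeJejjalaMinic2016 (2.1) and SekatskiiBeltraminelliMerlini2012 Remark 2).
* [SekatskiiBeltraminelliMerlini2012] Ukr. Math. J. 64 (2012), §3.1, Thm. 5a and Remark 2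
  (Volchkov's equality from the Poisson-type identities) [corpus: paper:doi-10-1007-s11253-012-0642-0].
* [HeJejjalaMinic2016] Y.-H. He, V. Jejjala, D. Minic, *From Veneziano to Riemann*, §2 (2.1).
* [Broughan2017] Vol. 2, Ch. 8 (not held).
-/

noncomputable section

open Complex Set Filter Topology MeasureTheory Real

namespace Literature.NumberTheory.LFunctions

namespace Volchkov

/-! ### §1 The Poisson kernel `P(a,t) = a/(a²+t²)`, its `a`-derivatives, and Volchkov's weight -/

/-- `∂_a [a/(a²+t²)] = (t²−a²)/(a²+t²)²` (`a ≠ 0` or `t ≠ 0`). [folklore] -/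
private theorem hasDerivAt_poisson {a t : ℝ} (h : a ^ 2 + t ^ 2 ≠ 0) :
    HasDerivAt (fun a : ℝ ↦ a / (a ^ 2 + t ^ 2)) ((t ^ 2 - a ^ 2) / (a ^ 2 + t ^ 2) ^ 2) a := by
  have h1 : HasDerivAt (fun a : ℝ ↦ a ^ 2 + t ^ 2) (2 * a) a := by
    simpa using (hasDerivAt_pow 2 a).add_const (t ^ 2)
  have := (hasDerivAt_id a).fun_div h1 h
  refine this.congr_deriv ?_
  simp only [id]
  field_simp
  ring

/-- `∂_a [(t²−a²)/(a²+t²)²] = 2a(a²−3t²)/(a²+t²)³`. [folklore] -/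
private theorem hasDerivAt_poisson_deriv {a t : ℝ} (h : a ^ 2 + t ^ 2 ≠ 0) :
    HasDerivAt (fun a : ℝ ↦ (t ^ 2 - a ^ 2) / (a ^ 2 + t ^ 2) ^ 2)
      (2 * a * (a ^ 2 - 3 * t ^ 2) / (a ^ 2 + t ^ 2) ^ 3) a := by
  have h1 : HasDerivAt (fun a : ℝ ↦ t ^ 2 - a ^ 2) (-(2 * a)) a := by
    simpa using (hasDerivAt_pow 2 a).const_sub (t ^ 2)
  have h2 : HasDerivAt (fun a : ℝ ↦ (a ^ 2 + t ^ 2) ^ 2) (2 * (a ^ 2 + t ^ 2) * (2 * a)) a := by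
    have h3 : HasDerivAt (fun a : ℝ ↦ a ^ 2 + t ^ 2) (2 * a) a := by
      simpa using (hasDerivAt_pow 2 a).add_const (t ^ 2)
    have := h3.fun_pow 2
    simpa using this
  have := h1.fun_div h2 (pow_ne_zero 2 h)
  refine this.congr_deriv ?_
  field_simp
  ring

/-- Volchkov's weight is `1/16` of the second `a`-derivative of the Poisson kernel at `a = 1/2`:
`2·(1/2)·(1/4 − 3t²)/(1/4+t²)³ = 16·(1−12t²)/(1+4t²)³`. [folklore] -/
private theorem poisson_deriv_two_half (t : ℝ) :
    2 * (1 / 2 : ℝ) * ((1 / 2) ^ 2 - 3 * t ^ 2) / ((1 / 2) ^ 2 + t ^ 2) ^ 3 =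
      16 * ((1 - 12 * t ^ 2) / (1 + 4 * t ^ 2) ^ 3) := by
  have h1 : (1 : ℝ) + 4 * t ^ 2 ≠ 0 := by positivity
  have h2 : ((1 / 2 : ℝ) ^ 2 + t ^ 2) ≠ 0 := by positivity
  field_simp
  ring

/-- For `1/4 < a`: `|(t²−a²)/(a²+t²)²| ≤ 1/(1/16+t²)`. [folklore] -/
private theorem abs_poisson_deriv_le {a : ℝ} (ha : 1 / 4 < a) (t : ℝ) :
    |(t ^ 2 - a ^ 2) / (a ^ 2 + t ^ 2) ^ 2| ≤ 1 / (1 / 16 + t ^ 2) := by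
  have hpos : 0 < a ^ 2 + t ^ 2 := by positivity
  have h16 : 0 < 1 / 16 + t ^ 2 := by positivity
  rw [abs_div, abs_of_pos (pow_pos hpos 2), div_le_div_iff₀ (pow_pos hpos 2) h16, one_mul]
  have h1 : |t ^ 2 - a ^ 2| ≤ a ^ 2 + t ^ 2 := by
    rw [abs_le]; constructor <;> nlinarith [sq_nonneg a, sq_nonneg t]
  have h2 : 1 / 16 + t ^ 2 ≤ a ^ 2 + t ^ 2 := by nlinarith
  calc |t ^ 2 - a ^ 2| * (1 / 16 + t ^ 2) ≤ (a ^ 2 + t ^ 2) * (a ^ 2 + t ^ 2) :=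
        mul_le_mul h1 h2 h16.le hpos.le
    _ = (a ^ 2 + t ^ 2) ^ 2 := by ring

/-- For `1/4 < a`: `|2a(a²−3t²)/(a²+t²)³| ≤ 24/(1/16+t²)`. [folklore] -/
private theorem abs_poisson_deriv_two_le {a : ℝ} (ha : 1 / 4 < a) (t : ℝ) :
    |2 * a * (a ^ 2 - 3 * t ^ 2) / (a ^ 2 + t ^ 2) ^ 3| ≤ 24 / (1 / 16 + t ^ 2) := by
  have ha0 : 0 < a := by linarith
  have hpos : 0 < a ^ 2 + t ^ 2 := by positivity
  have h16 : 0 < 1 / 16 + t ^ 2 := by positivity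
  rw [abs_div, abs_of_pos (pow_pos hpos 3), div_le_div_iff₀ (pow_pos hpos 3) h16]
  have h1 : |2 * a * (a ^ 2 - 3 * t ^ 2)| ≤ 6 * a * (a ^ 2 + t ^ 2) := by
    rw [abs_le]; constructor <;> nlinarith [sq_nonneg a, sq_nonneg t, mul_pos ha0 hpos]
  have h2 : 1 / 16 + t ^ 2 ≤ a ^ 2 + t ^ 2 := by nlinarith
  -- `6a(a²+t²)(1/16+t²) ≤ 24(a²+t²)³` since `6a(1/16+t²) ≤ 24(a²+t²)²` (`a > 1/4`)
  have h3 : 6 * a * (1 / 16 + t ^ 2) ≤ 24 * (a ^ 2 + t ^ 2) ^ 2 := by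
    have h4 : 6 * a ≤ 24 * (a ^ 2 + t ^ 2) := by nlinarith [sq_nonneg t, sq_nonneg (a - 1 / 8)]
    calc 6 * a * (1 / 16 + t ^ 2) ≤ 24 * (a ^ 2 + t ^ 2) * (a ^ 2 + t ^ 2) :=
          mul_le_mul h4 h2 h16.le (by positivity)
      _ = 24 * (a ^ 2 + t ^ 2) ^ 2 := by ring
  calc |2 * a * (a ^ 2 - 3 * t ^ 2)| * (1 / 16 + t ^ 2)
      ≤ 6 * a * (a ^ 2 + t ^ 2) * (1 / 16 + t ^ 2) := mul_le_mul_of_nonneg_right h1 h16.le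
    _ = (a ^ 2 + t ^ 2) * (6 * a * (1 / 16 + t ^ 2)) := by ring
    _ ≤ (a ^ 2 + t ^ 2) * (24 * (a ^ 2 + t ^ 2) ^ 2) := mul_le_mul_of_nonneg_left h3 hpos.le
    _ = 24 * (a ^ 2 + t ^ 2) ^ 3 := by ring

/-- Volchkov's weight against the Poisson kernel at `a = 1/2`:
`|(1−12t²)/(1+4t²)³| ≤ (3/2)·(1/2)/(1/4+t²)`. [folklore] -/
private theorem abs_weight_le (t : ℝ) :
    |(1 - 12 * t ^ 2) / (1 + 4 * t ^ 2) ^ 3| ≤ 3 / 2 * ((1 / 2) / ((1 / 2) ^ 2 + t ^ 2)) := by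
  have h1 : (0 : ℝ) < 1 + 4 * t ^ 2 := by positivity
  have h4 : (0 : ℝ) < (1 / 2) ^ 2 + t ^ 2 := by positivity
  rw [abs_div, abs_of_pos (pow_pos h1 3), div_le_iff₀ (pow_pos h1 3)]
  have h2 : |1 - 12 * t ^ 2| ≤ 3 * (1 + 4 * t ^ 2) := by
    rw [abs_le]; constructor <;> nlinarith [sq_nonneg t]
  have h3 : 3 / 2 * ((1 / 2) / ((1 / 2) ^ 2 + t ^ 2)) * (1 + 4 * t ^ 2) ^ 3 =
      3 * (1 + 4 * t ^ 2) * (1 + 4 * t ^ 2) := by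
    field_simp
    ring
  rw [h3]
  calc |1 - 12 * t ^ 2| ≤ 3 * (1 + 4 * t ^ 2) := h2
    _ = 3 * (1 + 4 * t ^ 2) * 1 := by ring
    _ ≤ 3 * (1 + 4 * t ^ 2) * (1 + 4 * t ^ 2) := by
        apply mul_le_mul_of_nonneg_left _ (by positivity); nlinarith [sq_nonneg t]

/-- `|(1−12t²)/(1+4t²)³| ≤ 1`. [folklore] -/
private theorem abs_weight_le_one (t : ℝ) : |(1 - 12 * t ^ 2) / (1 + 4 * t ^ 2) ^ 3| ≤ 1 := by
  have h1 : (0 : ℝ) < 1 + 4 * t ^ 2 := by positivity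
  rw [abs_div, abs_of_pos (pow_pos h1 3), div_le_one (pow_pos h1 3), abs_le]
  constructor <;> nlinarith [sq_nonneg t, pow_pos h1 2, sq_nonneg (t ^ 2), sq_nonneg (t ^ 3)]

/-! ### §2 `log|ζ(σ + it)|` as a measurable function of two variables; evenness in `t` -/

/-- `ζ` is Borel measurable (continuous off `s = 1`). [folklore] -/
private theorem measurable_riemannZeta' : Measurable riemannZeta :=
  measurable_of_continuousOn_compl_singleton 1
    fun _ hs ↦ (differentiableAt_riemannZeta hs).continuousAt.continuousWithinAt

/-- `(σ, t) ↦ log|ζ(σ+it)|` is measurable. [folklore] -/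
private theorem measurable_logZeta_uncurry :
    Measurable fun p : ℝ × ℝ ↦ Real.log ‖riemannZeta (p.1 + p.2 * I)‖ :=
  Real.measurable_log.comp (measurable_riemannZeta'.comp (by fun_prop)).norm

/-- For fixed `σ`, `t ↦ log|ζ(σ+it)|` is measurable. [folklore] -/
private theorem measurable_logZeta (σ : ℝ) :
    Measurable fun t : ℝ ↦ Real.log ‖riemannZeta (σ + t * I)‖ :=
  Real.measurable_log.comp (measurable_riemannZeta'.comp (by fun_prop)).norm

/-- For fixed `t`, `σ ↦ log|ζ(σ+it)|` is measurable. [folklore] -/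
private theorem measurable_logZeta_left (t : ℝ) :
    Measurable fun σ : ℝ ↦ Real.log ‖riemannZeta (σ + t * I)‖ :=
  Real.measurable_log.comp (measurable_riemannZeta'.comp (by fun_prop)).norm

/-- Evenness in `t`: `log|ζ(σ − it)| = log|ζ(σ + it)|` (`ζ(s̄) = conj ζ(s)`). [folklore] -/
private theorem logZeta_neg (σ t : ℝ) :
    Real.log ‖riemannZeta (σ + (-t : ℝ) * I)‖ = Real.log ‖riemannZeta (σ + t * I)‖ := by
  have h : (σ : ℂ) + ((-t : ℝ) : ℂ) * I = starRingEnd ℂ ((σ : ℂ) + t * I) := by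
    simp
  rw [h, riemannZeta_conj, Complex.norm_conj]

/-! ### §3 The Poisson means `H(σ,a) = ∫ log|ζ(σ+it)|·a/(a²+t²) dt` and their `a`-derivatives -/

/-- `ζ₁(x) ≠ 0` for real `x > 0` (`ζ₁ = (s−1)ζ`, `ζ₁(1) = 1`, `ζ(x) ≠ 0` on `(0,1)` and `[1,∞)`).
[folklore] -/
private theorem riemannZeta₁_ofReal_ne_zero' {x : ℝ} (hx : 0 < x) : riemannZeta₁ (x : ℂ) ≠ 0 := by
  by_cases h1 : x = 1
  · rw [h1, Complex.ofReal_one, riemannZeta₁_one]; exact one_ne_zero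
  have h1' : (x : ℂ) ≠ 1 := by exact_mod_cast h1
  rw [riemannZeta₁_eq_mul h1']
  refine mul_ne_zero (sub_ne_zero.2 h1') ?_
  rcases lt_or_gt_of_ne h1 with hlt | hgt
  · exact riemannZeta_ofReal_ne_zero_of_pos_of_lt_one x hx hlt
  · exact riemannZeta_ne_zero_of_one_le_re (by simp; linarith)

/-- **Integrability of the Poisson means** on every line `Re s = σ`, `σ ≥ 1/2`, `σ ≠ 1`:
`t ↦ log|ζ(σ+it)|/(1/16+t²)` is Lebesgue-integrable (from `sbm_hasSum` with `a = 1/4` for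
`σ < 1`, `sbm_poisson_of_one_lt` for `σ > 1`). [cite: SekatskiiBeltraminelliMerlini2012, Thm. 3 (convergence of the Poisson means)] -/
theorem integrable_logZeta_div {σ : ℝ} (hσ : 1 / 2 ≤ σ) (hσ1 : σ ≠ 1) :
    Integrable fun t : ℝ ↦ Real.log ‖riemannZeta (σ + t * I)‖ / (1 / 16 + t ^ 2) := by
  have ha : (0 : ℝ) < 1 / 4 := by norm_num
  have e : ∀ t : ℝ, (1 / 4 : ℝ) ^ 2 + t ^ 2 = 1 / 16 + t ^ 2 := fun t ↦ by norm_num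
  rcases lt_or_gt_of_ne hσ1 with hlt | hgt
  · have h0 : riemannZeta₁ ((1 / 4 + σ : ℝ) : ℂ) ≠ 0 := riemannZeta₁_ofReal_ne_zero' (by linarith)
    have h := (sbm_hasSum ha hσ hlt h0).1
    simp_rw [e] at h
    exact h
  · have h := (sbm_poisson_of_one_lt ha hgt).1
    simp_rw [e] at h
    exact h

/-- Integrability of `log|ζ(σ+it)|·g(t)` for any measurable `g` with `|g| ≤ C/(1/16+t²)`.
[folklore] -/
private theorem integrable_logZeta_mul {σ : ℝ} (hσ : 1 / 2 ≤ σ) (hσ1 : σ ≠ 1) {g : ℝ → ℝ}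
    (hg : Measurable g) {C : ℝ} (hC : ∀ t, |g t| ≤ C / (1 / 16 + t ^ 2)) :
    Integrable fun t : ℝ ↦ Real.log ‖riemannZeta (σ + t * I)‖ * g t := by
  have h := (integrable_logZeta_div hσ hσ1).norm.const_mul C
  refine h.mono' (((measurable_logZeta σ).mul hg).aestronglyMeasurable) (ae_of_all _ fun t ↦ ?_)
  have h16 : (0 : ℝ) < 1 / 16 + t ^ 2 := by positivity
  rw [Real.norm_eq_abs, abs_mul, Real.norm_eq_abs, abs_div, abs_of_pos h16]
  calc |Real.log ‖riemannZeta (σ + t * I)‖| * |g t|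
      ≤ |Real.log ‖riemannZeta (σ + t * I)‖| * (C / (1 / 16 + t ^ 2)) :=
        mul_le_mul_of_nonneg_left (hC t) (abs_nonneg _)
    _ = C * (|Real.log ‖riemannZeta (σ + t * I)‖| / (1 / 16 + t ^ 2)) := by ring

/-- **First `a`-derivative of the Poisson mean** (dominated differentiation under the integral):
for `σ ≥ 1/2`, `σ ≠ 1`, `1/4 < a < 1`,
`d/da ∫ log|ζ(σ+it)| a/(a²+t²) dt = ∫ log|ζ(σ+it)| (t²−a²)/(a²+t²)² dt`. [folklore] -/
private theorem hasDerivAt_poissonMean {σ : ℝ} (hσ : 1 / 2 ≤ σ) (hσ1 : σ ≠ 1) {a : ℝ} (ha : 1 / 4 < a)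
    (ha1 : a < 1) :
    HasDerivAt (fun a : ℝ ↦ ∫ t : ℝ, Real.log ‖riemannZeta (σ + t * I)‖ * (a / (a ^ 2 + t ^ 2)))
      (∫ t : ℝ, Real.log ‖riemannZeta (σ + t * I)‖ * ((t ^ 2 - a ^ 2) / (a ^ 2 + t ^ 2) ^ 2)) a := by
  have hs : Ioo (1 / 4 : ℝ) 1 ∈ 𝓝 a := Ioo_mem_nhds ha ha1
  have hmeasP : ∀ x : ℝ, Measurable fun t : ℝ ↦ x / (x ^ 2 + t ^ 2) := fun x ↦ by fun_prop
  have hmeasP₁ : ∀ x : ℝ, Measurable fun t : ℝ ↦ (t ^ 2 - x ^ 2) / (x ^ 2 + t ^ 2) ^ 2 :=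
    fun x ↦ by fun_prop
  refine (hasDerivAt_integral_of_dominated_loc_of_deriv_le
    (F := fun (x : ℝ) (t : ℝ) ↦ Real.log ‖riemannZeta (σ + t * I)‖ * (x / (x ^ 2 + t ^ 2)))
    (F' := fun (x : ℝ) (t : ℝ) ↦
      Real.log ‖riemannZeta (σ + t * I)‖ * ((t ^ 2 - x ^ 2) / (x ^ 2 + t ^ 2) ^ 2))
    (bound := fun (t : ℝ) ↦ |Real.log ‖riemannZeta (σ + t * I)‖| * (1 / (1 / 16 + t ^ 2)))
    hs ?_ ?_ ?_ ?_ ?_ ?_).2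
  · exact Eventually.of_forall fun x ↦ ((measurable_logZeta σ).mul (hmeasP x)).aestronglyMeasurable
  · refine integrable_logZeta_mul hσ hσ1 (hmeasP a) (C := 1) fun t ↦ ?_
    have hpos : 0 < a ^ 2 + t ^ 2 := by positivity
    rw [abs_div, abs_of_pos (by linarith : (0 : ℝ) < a), abs_of_pos hpos,
      div_le_div_iff₀ hpos (by positivity)]
    nlinarith [sq_nonneg t]
  · exact ((measurable_logZeta σ).mul (hmeasP₁ a)).aestronglyMeasurable
  · refine ae_of_all _ fun t x hx ↦ ?_
    rw [Real.norm_eq_abs, abs_mul]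
    exact mul_le_mul_of_nonneg_left (abs_poisson_deriv_le hx.1 t) (abs_nonneg _)
  · have h := (integrable_logZeta_div hσ hσ1).norm
    refine h.congr (ae_of_all _ fun t ↦ ?_)
    have h16 : (0 : ℝ) < 1 / 16 + t ^ 2 := by positivity
    simp only [Real.norm_eq_abs, abs_div, abs_of_pos h16]
    ring
  · refine ae_of_all _ fun t x hx ↦ ?_
    have hx0 : x ^ 2 + t ^ 2 ≠ 0 := by
      have : (0 : ℝ) < x := by linarith [hx.1]
      positivity
    exact (hasDerivAt_poisson hx0).const_mul _

/-- **Second `a`-derivative of the Poisson mean**: for `σ ≥ 1/2`, `σ ≠ 1`, `1/4 < a < 1`,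
`d/da ∫ log|ζ(σ+it)| (t²−a²)/(a²+t²)² dt = ∫ log|ζ(σ+it)| 2a(a²−3t²)/(a²+t²)³ dt`. [folklore] -/
private theorem hasDerivAt_poissonMean_deriv {σ : ℝ} (hσ : 1 / 2 ≤ σ) (hσ1 : σ ≠ 1) {a : ℝ}
    (ha : 1 / 4 < a) (ha1 : a < 1) :
    HasDerivAt
      (fun a : ℝ ↦ ∫ t : ℝ, Real.log ‖riemannZeta (σ + t * I)‖ * ((t ^ 2 - a ^ 2) / (a ^ 2 + t ^ 2) ^ 2))
      (∫ t : ℝ, Real.log ‖riemannZeta (σ + t * I)‖ *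
        (2 * a * (a ^ 2 - 3 * t ^ 2) / (a ^ 2 + t ^ 2) ^ 3)) a := by
  have hs : Ioo (1 / 4 : ℝ) 1 ∈ 𝓝 a := Ioo_mem_nhds ha ha1
  have hmeasP₁ : ∀ x : ℝ, Measurable fun t : ℝ ↦ (t ^ 2 - x ^ 2) / (x ^ 2 + t ^ 2) ^ 2 :=
    fun x ↦ by fun_prop
  have hmeasP₂ : ∀ x : ℝ, Measurable fun t : ℝ ↦ 2 * x * (x ^ 2 - 3 * t ^ 2) / (x ^ 2 + t ^ 2) ^ 3 :=
    fun x ↦ by fun_prop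
  refine (hasDerivAt_integral_of_dominated_loc_of_deriv_le
    (F := fun (x : ℝ) (t : ℝ) ↦
      Real.log ‖riemannZeta (σ + t * I)‖ * ((t ^ 2 - x ^ 2) / (x ^ 2 + t ^ 2) ^ 2))
    (F' := fun (x : ℝ) (t : ℝ) ↦ Real.log ‖riemannZeta (σ + t * I)‖ *
      (2 * x * (x ^ 2 - 3 * t ^ 2) / (x ^ 2 + t ^ 2) ^ 3))
    (bound := fun (t : ℝ) ↦ |Real.log ‖riemannZeta (σ + t * I)‖| * (24 / (1 / 16 + t ^ 2)))
    hs ?_ ?_ ?_ ?_ ?_ ?_).2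
  · exact Eventually.of_forall fun x ↦ ((measurable_logZeta σ).mul (hmeasP₁ x)).aestronglyMeasurable
  · exact integrable_logZeta_mul hσ hσ1 (hmeasP₁ a) (C := 1) fun t ↦ abs_poisson_deriv_le ha t
  · exact ((measurable_logZeta σ).mul (hmeasP₂ a)).aestronglyMeasurable
  · refine ae_of_all _ fun t x hx ↦ ?_
    rw [Real.norm_eq_abs, abs_mul]
    exact mul_le_mul_of_nonneg_left (abs_poisson_deriv_two_le hx.1 t) (abs_nonneg _)
  · have h := ((integrable_logZeta_div hσ hσ1).norm.const_mul 24)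
    refine h.congr (ae_of_all _ fun t ↦ ?_)
    have h16 : (0 : ℝ) < 1 / 16 + t ^ 2 := by positivity
    simp only [Real.norm_eq_abs, abs_div, abs_of_pos h16]
    ring
  · refine ae_of_all _ fun t x hx ↦ ?_
    have hx0 : x ^ 2 + t ^ 2 ≠ 0 := by
      have : (0 : ℝ) < x := by linarith [hx.1]
      positivity
    exact (hasDerivAt_poisson_deriv hx0).const_mul _

/-- The second-derivative integrand at `a = 1/2` is `32 ∫₀^∞` of Volchkov's integrand (the
weight identity of §1 and evenness in `t`). [folklore] -/
private theorem integral_logZeta_mul_poisson_deriv_two_half (σ : ℝ) :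
    ∫ t : ℝ, Real.log ‖riemannZeta (σ + t * I)‖ *
        (2 * (1 / 2 : ℝ) * ((1 / 2) ^ 2 - 3 * t ^ 2) / ((1 / 2) ^ 2 + t ^ 2) ^ 3) =
      32 * ∫ t in Ioi (0 : ℝ), (1 - 12 * t ^ 2) / (1 + 4 * t ^ 2) ^ 3 *
        Real.log ‖riemannZeta (σ + t * I)‖ := by
  have e : ∀ t : ℝ, Real.log ‖riemannZeta (σ + t * I)‖ *
      (2 * (1 / 2 : ℝ) * ((1 / 2) ^ 2 - 3 * t ^ 2) / ((1 / 2) ^ 2 + t ^ 2) ^ 3) =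
      16 * ((fun u : ℝ ↦ (1 - 12 * u ^ 2) / (1 + 4 * u ^ 2) ^ 3 *
        Real.log ‖riemannZeta (σ + u * I)‖) |t|) := by
    intro t
    rw [poisson_deriv_two_half t]
    simp only [sq_abs]
    rcases le_or_gt 0 t with ht | ht
    · rw [abs_of_nonneg ht]; ring
    · rw [abs_of_neg ht, logZeta_neg σ t]; ring
  simp_rw [e]
  rw [integral_const_mul, integral_comp_abs
    (f := fun u : ℝ ↦ (1 - 12 * u ^ 2) / (1 + 4 * u ^ 2) ^ 3 * Real.log ‖riemannZeta (σ + u * I)‖)]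
  ring

/-! ### §4 The zero terms `log(|ρ−σ+a|/|ρ−σ−a|)` as functions of `a` -/

/-- `log(‖ρ−σ+a‖/‖ρ−σ−a‖) = ½[log((β−σ+a)²+γ²) − log((β−σ−a)²+γ²)]` (`ρ = β+iγ`, `γ ≠ 0`).
[folklore] -/
private theorem log_norm_ratio_eq {ρ : ℂ} (hγ : ρ.im ≠ 0) (σ a : ℝ) :
    Real.log (‖ρ - σ + a‖ / ‖ρ - σ - a‖) =
      1 / 2 * (Real.log ((ρ.re - σ + a) ^ 2 + ρ.im ^ 2) -
        Real.log ((ρ.re - σ - a) ^ 2 + ρ.im ^ 2)) := by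
  have hγ2 : 0 < ρ.im ^ 2 := by positivity
  have hA : 0 < (ρ.re - σ + a) ^ 2 + ρ.im ^ 2 := by positivity
  have hB : 0 < (ρ.re - σ - a) ^ 2 + ρ.im ^ 2 := by positivity
  have e1 : ‖ρ - σ + a‖ = Real.sqrt ((ρ.re - σ + a) ^ 2 + ρ.im ^ 2) := by
    rw [Complex.norm_eq_sqrt_sq_add_sq]; simp
  have e2 : ‖ρ - σ - a‖ = Real.sqrt ((ρ.re - σ - a) ^ 2 + ρ.im ^ 2) := by
    rw [Complex.norm_eq_sqrt_sq_add_sq]; simp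
  rw [e1, e2, Real.log_div (Real.sqrt_ne_zero'.2 hA) (Real.sqrt_ne_zero'.2 hB),
    Real.log_sqrt hA.le, Real.log_sqrt hB.le]
  ring

/-- `d/dx [x/(x²+γ²)] = (γ²−x²)/(x²+γ²)²` composed with `x = c + a` and `x = c − a`:
the first `a`-derivative of the zero term. [folklore] -/
private theorem hasDerivAt_log_norm_ratio {ρ : ℂ} (hγ : ρ.im ≠ 0) (σ a : ℝ) :
    HasDerivAt (fun a : ℝ ↦ Real.log (‖ρ - σ + a‖ / ‖ρ - σ - a‖))
      ((ρ.re - σ + a) / ((ρ.re - σ + a) ^ 2 + ρ.im ^ 2) +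
        (ρ.re - σ - a) / ((ρ.re - σ - a) ^ 2 + ρ.im ^ 2)) a := by
  have hγ2 : 0 < ρ.im ^ 2 := by positivity
  have hfun : (fun a : ℝ ↦ Real.log (‖ρ - σ + a‖ / ‖ρ - σ - a‖)) = fun a : ℝ ↦
      1 / 2 * (Real.log ((ρ.re - σ + a) ^ 2 + ρ.im ^ 2) -
        Real.log ((ρ.re - σ - a) ^ 2 + ρ.im ^ 2)) := funext fun a ↦ log_norm_ratio_eq hγ σ a
  rw [hfun]
  have hA : (ρ.re - σ + a) ^ 2 + ρ.im ^ 2 ≠ 0 := by positivity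
  have hB : (ρ.re - σ - a) ^ 2 + ρ.im ^ 2 ≠ 0 := by positivity
  have h1 : HasDerivAt (fun a : ℝ ↦ (ρ.re - σ + a) ^ 2 + ρ.im ^ 2) (2 * (ρ.re - σ + a)) a := by
    have := (((hasDerivAt_id a).const_add (ρ.re - σ)).fun_pow 2).add_const (ρ.im ^ 2)
    simpa using this
  have h2 : HasDerivAt (fun a : ℝ ↦ (ρ.re - σ - a) ^ 2 + ρ.im ^ 2) (-(2 * (ρ.re - σ - a))) a := by
    have := (((hasDerivAt_id a).const_sub (ρ.re - σ)).fun_pow 2).add_const (ρ.im ^ 2)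
    simpa using this
  have := ((h1.log hA).sub (h2.log hB)).const_mul (1 / 2 : ℝ)
  refine this.congr_deriv ?_
  field_simp
  ring

/-- The second `a`-derivative of the zero term:
`d/da [(c+a)/((c+a)²+γ²) + (c−a)/((c−a)²+γ²)] = q'(c+a) − q'(c−a)`,
`q'(x) = (γ²−x²)/(x²+γ²)²`. [folklore] -/
private theorem hasDerivAt_log_norm_ratio_deriv {ρ : ℂ} (hγ : ρ.im ≠ 0) (σ a : ℝ) :
    HasDerivAt (fun a : ℝ ↦ (ρ.re - σ + a) / ((ρ.re - σ + a) ^ 2 + ρ.im ^ 2) +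
        (ρ.re - σ - a) / ((ρ.re - σ - a) ^ 2 + ρ.im ^ 2))
      ((ρ.im ^ 2 - (ρ.re - σ + a) ^ 2) / ((ρ.re - σ + a) ^ 2 + ρ.im ^ 2) ^ 2 -
        (ρ.im ^ 2 - (ρ.re - σ - a) ^ 2) / ((ρ.re - σ - a) ^ 2 + ρ.im ^ 2) ^ 2) a := by
  have hγ2 : 0 < ρ.im ^ 2 := by positivity
  have hA : (ρ.re - σ + a) ^ 2 + ρ.im ^ 2 ≠ 0 := by positivity
  have hB : (ρ.re - σ - a) ^ 2 + ρ.im ^ 2 ≠ 0 := by positivity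
  -- `q(x) = x/(x²+γ²)` composed with `x = c + a` and `x = c − a`
  have hq1 := hasDerivAt_poisson (a := ρ.re - σ + a) (t := ρ.im) hA
  have hq2 := hasDerivAt_poisson (a := ρ.re - σ - a) (t := ρ.im) hB
  have hl1 : HasDerivAt (fun a : ℝ ↦ ρ.re - σ + a) 1 a := by
    simpa using (hasDerivAt_id a).const_add (ρ.re - σ)
  have hl2 : HasDerivAt (fun a : ℝ ↦ ρ.re - σ - a) (-1) a := by
    simpa using (hasDerivAt_id a).const_sub (ρ.re - σ)
  have hc1 := hq1.comp a hl1
  have hc2 := hq2.comp a hl2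
  have := hc1.add hc2
  refine this.congr_deriv ?_
  simp only [mul_one, mul_neg_one]
  ring

/-- Size of `q(x) = x/(x²+γ²)`: `|q(x)| ≤ |x|/γ²`. [folklore] -/
private theorem abs_div_sq_add_sq_le {γ : ℝ} (hγ : γ ≠ 0) (x : ℝ) :
    |x / (x ^ 2 + γ ^ 2)| ≤ |x| / γ ^ 2 := by
  have hγ2 : 0 < γ ^ 2 := by positivity
  have hpos : 0 < x ^ 2 + γ ^ 2 := by positivity
  rw [abs_div, abs_of_pos hpos]
  exact div_le_div_of_nonneg_left (abs_nonneg x) hγ2 (by nlinarith [sq_nonneg x])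

/-- Size of `q'(x) = (γ²−x²)/(x²+γ²)²`: `|q'(x)| ≤ 1/γ²`. [folklore] -/
private theorem abs_poissonDeriv_le_inv_sq {γ : ℝ} (hγ : γ ≠ 0) (x : ℝ) :
    |(γ ^ 2 - x ^ 2) / (x ^ 2 + γ ^ 2) ^ 2| ≤ 1 / γ ^ 2 := by
  have hγ2 : 0 < γ ^ 2 := by positivity
  have hpos : 0 < x ^ 2 + γ ^ 2 := by positivity
  rw [abs_div, abs_of_pos (pow_pos hpos 2), div_le_div_iff₀ (pow_pos hpos 2) hγ2, one_mul]
  have h1 : |γ ^ 2 - x ^ 2| ≤ x ^ 2 + γ ^ 2 := by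
    rw [abs_le]; constructor <;> nlinarith [sq_nonneg x, sq_nonneg γ]
  calc |γ ^ 2 - x ^ 2| * γ ^ 2 ≤ (x ^ 2 + γ ^ 2) * (x ^ 2 + γ ^ 2) :=
        mul_le_mul h1 (by nlinarith [sq_nonneg x]) hγ2.le hpos.le
    _ = (x ^ 2 + γ ^ 2) ^ 2 := by ring

/-! ### §5 The identity on the lines `Re s = σ` over the fixed index set of non-trivial zeros

The zero sum of `sbm_hasSum` runs over `{ρ : ρ ∈ 𝒵, Re ρ > σ}`; we rewrite it as a sum over the
σ-independent index type `𝒵 = ZetaZeros.riemannZetaNontrivialZeros` of the terms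
`T(ρ,σ,a) = [σ < Re ρ]·m(ρ)·log(|ρ−σ+a|/|ρ−σ−a|)`, so that it can be differentiated in `a` and
integrated in `σ` term by term. -/

/-- Non-trivial zeros have `γ² ≥ 1` (indeed `|γ| > 14`), so `1/γ² ≤ 2/(1+γ²)`. [folklore] -/
private theorem inv_im_sq_le (ρ : ZetaZeros.riemannZetaNontrivialZeros) :
    1 / (ρ : ℂ).im ^ 2 ≤ 2 / (1 + (ρ : ℂ).im ^ 2) := by
  have h14 : 14 < |(ρ : ℂ).im| := FordL33.fourteen_lt_abs_im ρ
  have h1 : 1 ≤ (ρ : ℂ).im ^ 2 := by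
    have : (1 : ℝ) ≤ |(ρ : ℂ).im| := by linarith
    nlinarith [sq_abs (ρ : ℂ).im]
  have hγ2 : 0 < (ρ : ℂ).im ^ 2 := by positivity
  rw [div_le_div_iff₀ hγ2 (by positivity)]
  nlinarith

/-- **The Poisson-mean identity with its zero sum over the fixed index set** (`1/2 ≤ σ < 1`,
`a > 0`): `HasSum_{ρ ∈ 𝒵} [σ < Re ρ] m(ρ) log(|ρ−σ+a|/|ρ−σ−a|) =
(a/π)∫ log|ζ(σ+it)|/(a²+t²) − log|ζ₁(a+σ)| + log(a−σ+1)`. [cite: SekatskiiBeltraminelliMerlini2012, Thm. 3 with the zero contributions of §3.1] -/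
theorem hasSum_zeroTerm {σ : ℝ} (hσ : 1 / 2 ≤ σ) (hσ1 : σ < 1) {a : ℝ} (ha : 0 < a) :
    HasSum (fun ρ : ZetaZeros.riemannZetaNontrivialZeros ↦
        if σ < (ρ : ℂ).re then
          (riemannZetaZeroOrder (ρ : ℂ) : ℝ) * Real.log (‖(ρ : ℂ) - σ + a‖ / ‖(ρ : ℂ) - σ - a‖)
        else 0)
      (sbmPoissonLogIntegral a σ - Real.log ‖riemannZeta₁ ((a + σ : ℝ) : ℂ)‖ +
        Real.log (a - σ + 1)) := by
  have h0 : riemannZeta₁ ((a + σ : ℝ) : ℂ) ≠ 0 := riemannZeta₁_ofReal_ne_zero' (by linarith)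
  have h := (sbm_hasSum ha hσ hσ1 h0).2
  set F : ℂ → ℝ := fun ρ ↦
    (riemannZetaZeroOrder ρ : ℝ) * Real.log (‖ρ - σ + a‖ / ‖ρ - σ - a‖) with hF
  set s : Set ℂ := {ρ | ρ ∈ ZetaZeros.riemannZetaNontrivialZeros ∧ σ < ρ.re} with hs
  have h1 : HasSum (F ∘ (↑) : s → ℝ) (sbmPoissonLogIntegral a σ -
      Real.log ‖riemannZeta₁ ((a + σ : ℝ) : ℂ)‖ + Real.log (a - σ + 1)) := h
  rw [hasSum_subtype_iff_indicator] at h1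
  have hsupp : Function.support (s.indicator F) ⊆ ZetaZeros.riemannZetaNontrivialZeros :=
    (Set.support_indicator_subset).trans fun ρ hρ ↦ hρ.1
  have h2 := (hasSum_subtype_iff_of_support_subset hsupp).2 h1
  convert h2 using 1
  funext ρ
  simp only [Function.comp_apply, hs, hF]
  by_cases hlt : σ < (ρ : ℂ).re
  · simp [hlt, ρ.2]
  · simp [hlt]

/-- `Σ_ρ m(ρ)/(1+γ²) < ∞` over the non-trivial zeros (tree: `ZetaZeroSum`). [folklore] -/
private theorem summable_order_div_one_add_im_sq :
    Summable fun ρ : ZetaZeros.riemannZetaNontrivialZeros ↦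
      (riemannZetaZeroOrder (ρ : ℂ) : ℝ) / (1 + (ρ : ℂ).im ^ 2) :=
  ZetaZeroSum.summable_zeroOrder_div_one_add_sq

/-- Multiplicities are non-negative reals. [folklore] -/
private theorem order_nonneg (ρ : ZetaZeros.riemannZetaNontrivialZeros) :
    (0 : ℝ) ≤ (riemannZetaZeroOrder (ρ : ℂ) : ℝ) := by
  have h : (0 : ℤ) ≤ riemannZetaZeroOrder (ρ : ℂ) :=
    le_trans zero_le_one (ZetaZeros.riemannZetaNontrivialZeros.one_le_order ρ.2)
  exact_mod_cast h

/-- Bound for the first `a`-derivative of a zero term: for `ρ ∈ 𝒵` with `σ < Re ρ`, `1/2 ≤ σ`,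
`0 < a < 1`: `|m(ρ)(q(β−σ+a) + q(β−σ−a))| ≤ 5 m(ρ)/(1+γ²)`. [folklore] -/
private theorem abs_zeroTerm_deriv_le (ρ : ZetaZeros.riemannZetaNontrivialZeros) {σ : ℝ} (hσ : 1 / 2 ≤ σ)
    (hlt : σ < (ρ : ℂ).re) {a : ℝ} (ha : a ∈ Ioo (0 : ℝ) 1) :
    |(riemannZetaZeroOrder (ρ : ℂ) : ℝ) *
        (((ρ : ℂ).re - σ + a) / (((ρ : ℂ).re - σ + a) ^ 2 + (ρ : ℂ).im ^ 2) +
          ((ρ : ℂ).re - σ - a) / (((ρ : ℂ).re - σ - a) ^ 2 + (ρ : ℂ).im ^ 2))| ≤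
      5 * ((riemannZetaZeroOrder (ρ : ℂ) : ℝ) / (1 + (ρ : ℂ).im ^ 2)) := by
  have hγ : (ρ : ℂ).im ≠ 0 := ZetaZeros.riemannZetaNontrivialZeros.im_ne_zero ρ.2
  have hβ1 : (ρ : ℂ).re < 1 := ZetaZeros.riemannZetaNontrivialZeros.re_lt_one ρ.2
  have hm0 : (0 : ℝ) ≤ riemannZetaZeroOrder (ρ : ℂ) := order_nonneg ρ
  have hγ2 : 0 < (ρ : ℂ).im ^ 2 := by positivity
  have h1 := abs_div_sq_add_sq_le hγ ((ρ : ℂ).re - σ + a)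
  have h2 := abs_div_sq_add_sq_le hγ ((ρ : ℂ).re - σ - a)
  have hx1 : |(ρ : ℂ).re - σ + a| ≤ 3 / 2 := by
    rw [abs_le]; constructor <;> linarith [ha.1, ha.2]
  have hx2 : |(ρ : ℂ).re - σ - a| ≤ 1 := by
    rw [abs_le]; constructor <;> linarith [ha.1, ha.2]
  have hinv := inv_im_sq_le ρ
  rw [abs_mul, abs_of_nonneg hm0]
  have hsum : |((ρ : ℂ).re - σ + a) / (((ρ : ℂ).re - σ + a) ^ 2 + (ρ : ℂ).im ^ 2) +
      ((ρ : ℂ).re - σ - a) / (((ρ : ℂ).re - σ - a) ^ 2 + (ρ : ℂ).im ^ 2)| ≤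
      5 / (1 + (ρ : ℂ).im ^ 2) := by
    refine (abs_add_le _ _).trans ?_
    calc |((ρ : ℂ).re - σ + a) / (((ρ : ℂ).re - σ + a) ^ 2 + (ρ : ℂ).im ^ 2)| +
          |((ρ : ℂ).re - σ - a) / (((ρ : ℂ).re - σ - a) ^ 2 + (ρ : ℂ).im ^ 2)|
        ≤ |(ρ : ℂ).re - σ + a| / (ρ : ℂ).im ^ 2 + |(ρ : ℂ).re - σ - a| / (ρ : ℂ).im ^ 2 :=
          add_le_add h1 h2
      _ ≤ (3 / 2) / (ρ : ℂ).im ^ 2 + 1 / (ρ : ℂ).im ^ 2 := by gcongr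
      _ = (5 / 2) * (1 / (ρ : ℂ).im ^ 2) := by ring
      _ ≤ (5 / 2) * (2 / (1 + (ρ : ℂ).im ^ 2)) := by gcongr
      _ = 5 / (1 + (ρ : ℂ).im ^ 2) := by ring
  calc (riemannZetaZeroOrder (ρ : ℂ) : ℝ) * |((ρ : ℂ).re - σ + a) /
        (((ρ : ℂ).re - σ + a) ^ 2 + (ρ : ℂ).im ^ 2) +
        ((ρ : ℂ).re - σ - a) / (((ρ : ℂ).re - σ - a) ^ 2 + (ρ : ℂ).im ^ 2)|
      ≤ (riemannZetaZeroOrder (ρ : ℂ) : ℝ) * (5 / (1 + (ρ : ℂ).im ^ 2)) :=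
        mul_le_mul_of_nonneg_left hsum hm0
    _ = 5 * ((riemannZetaZeroOrder (ρ : ℂ) : ℝ) / (1 + (ρ : ℂ).im ^ 2)) := by ring

/-- Bound for the second `a`-derivative of a zero term: `|m(ρ)(q'(β−σ+a) − q'(β−σ−a))| ≤
4 m(ρ)/(1+γ²)`. [folklore] -/
private theorem abs_zeroTerm_deriv_two_le (ρ : ZetaZeros.riemannZetaNontrivialZeros) (σ a : ℝ) :
    |(riemannZetaZeroOrder (ρ : ℂ) : ℝ) *
        (((ρ : ℂ).im ^ 2 - ((ρ : ℂ).re - σ + a) ^ 2) / (((ρ : ℂ).re - σ + a) ^ 2 + (ρ : ℂ).im ^ 2) ^ 2 -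
          ((ρ : ℂ).im ^ 2 - ((ρ : ℂ).re - σ - a) ^ 2) /
            (((ρ : ℂ).re - σ - a) ^ 2 + (ρ : ℂ).im ^ 2) ^ 2)| ≤
      4 * ((riemannZetaZeroOrder (ρ : ℂ) : ℝ) / (1 + (ρ : ℂ).im ^ 2)) := by
  have hγ : (ρ : ℂ).im ≠ 0 := ZetaZeros.riemannZetaNontrivialZeros.im_ne_zero ρ.2
  have hm0 : (0 : ℝ) ≤ riemannZetaZeroOrder (ρ : ℂ) := order_nonneg ρ
  have hγ2 : 0 < (ρ : ℂ).im ^ 2 := by positivity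
  have h1 := abs_poissonDeriv_le_inv_sq hγ ((ρ : ℂ).re - σ + a)
  have h2 := abs_poissonDeriv_le_inv_sq hγ ((ρ : ℂ).re - σ - a)
  have hinv := inv_im_sq_le ρ
  rw [abs_mul, abs_of_nonneg hm0]
  have hsum : |((ρ : ℂ).im ^ 2 - ((ρ : ℂ).re - σ + a) ^ 2) /
        (((ρ : ℂ).re - σ + a) ^ 2 + (ρ : ℂ).im ^ 2) ^ 2 -
        ((ρ : ℂ).im ^ 2 - ((ρ : ℂ).re - σ - a) ^ 2) /
          (((ρ : ℂ).re - σ - a) ^ 2 + (ρ : ℂ).im ^ 2) ^ 2| ≤ 4 / (1 + (ρ : ℂ).im ^ 2) := by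
    refine (abs_sub _ _).trans ?_
    calc _ ≤ 1 / (ρ : ℂ).im ^ 2 + 1 / (ρ : ℂ).im ^ 2 := add_le_add h1 h2
      _ = 2 * (1 / (ρ : ℂ).im ^ 2) := by ring
      _ ≤ 2 * (2 / (1 + (ρ : ℂ).im ^ 2)) := by gcongr
      _ = 4 / (1 + (ρ : ℂ).im ^ 2) := by ring
  calc _ ≤ (riemannZetaZeroOrder (ρ : ℂ) : ℝ) * (4 / (1 + (ρ : ℂ).im ^ 2)) :=
        mul_le_mul_of_nonneg_left hsum hm0
    _ = 4 * ((riemannZetaZeroOrder (ρ : ℂ) : ℝ) / (1 + (ρ : ℂ).im ^ 2)) := by ring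

/-- Summability of the zero terms at every `a > 0` (`σ ≥ 1/2`; for `σ ≥ 1` all terms vanish,
the non-trivial zeros having `Re ρ < 1`). [folklore] -/
private theorem summable_zeroTerm {σ : ℝ} (hσ : 1 / 2 ≤ σ) {a : ℝ} (ha : 0 < a) :
    Summable fun ρ : ZetaZeros.riemannZetaNontrivialZeros ↦
      if σ < (ρ : ℂ).re then
        (riemannZetaZeroOrder (ρ : ℂ) : ℝ) * Real.log (‖(ρ : ℂ) - σ + a‖ / ‖(ρ : ℂ) - σ - a‖)
      else 0 := by
  by_cases hσ1 : σ < 1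
  · exact (hasSum_zeroTerm hσ hσ1 ha).summable
  · have h0 : (fun ρ : ZetaZeros.riemannZetaNontrivialZeros ↦
        if σ < (ρ : ℂ).re then
          (riemannZetaZeroOrder (ρ : ℂ) : ℝ) * Real.log (‖(ρ : ℂ) - σ + a‖ / ‖(ρ : ℂ) - σ - a‖)
        else 0) = fun _ ↦ 0 := by
      funext ρ
      have hβ1 : (ρ : ℂ).re < 1 := ZetaZeros.riemannZetaNontrivialZeros.re_lt_one ρ.2
      rw [if_neg (by linarith)]
    rw [h0]
    exact summable_zero

/-- For `σ ≥ 1` the zero sum vanishes identically (every non-trivial zero has `Re ρ < 1`).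
[folklore] -/
private theorem zeroSum_eq_zero_of_one_le {σ : ℝ} (hσ : 1 ≤ σ) (F : ZetaZeros.riemannZetaNontrivialZeros → ℝ) :
    (∑' ρ : ZetaZeros.riemannZetaNontrivialZeros, if σ < (ρ : ℂ).re then F ρ else 0) = 0 := by
  have h0 : (fun ρ : ZetaZeros.riemannZetaNontrivialZeros ↦ if σ < (ρ : ℂ).re then F ρ else 0) =
      fun _ ↦ 0 := by
    funext ρ
    have hβ1 : (ρ : ℂ).re < 1 := ZetaZeros.riemannZetaNontrivialZeros.re_lt_one ρ.2
    rw [if_neg (by linarith)]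
  rw [h0, tsum_zero]

/-- **Term-wise differentiation of the zero sum, first derivative** (`1/2 ≤ σ`, `0 < a < 1`):
`d/da Σ_ρ T(ρ,σ,a) = Σ_ρ [σ<Re ρ] m(ρ)(q(β−σ+a) + q(β−σ−a))`, `q(x) = x/(x²+γ²)`, and the
derivative series is summable. [folklore] -/
private theorem hasDerivAt_zeroSum {σ : ℝ} (hσ : 1 / 2 ≤ σ) {a : ℝ} (ha : a ∈ Ioo (0 : ℝ) 1) :
    HasDerivAt
      (fun a : ℝ ↦ ∑' ρ : ZetaZeros.riemannZetaNontrivialZeros,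
        if σ < (ρ : ℂ).re then
          (riemannZetaZeroOrder (ρ : ℂ) : ℝ) * Real.log (‖(ρ : ℂ) - σ + a‖ / ‖(ρ : ℂ) - σ - a‖)
        else 0)
      (∑' ρ : ZetaZeros.riemannZetaNontrivialZeros,
        if σ < (ρ : ℂ).re then
          (riemannZetaZeroOrder (ρ : ℂ) : ℝ) *
            (((ρ : ℂ).re - σ + a) / (((ρ : ℂ).re - σ + a) ^ 2 + (ρ : ℂ).im ^ 2) +
              ((ρ : ℂ).re - σ - a) / (((ρ : ℂ).re - σ - a) ^ 2 + (ρ : ℂ).im ^ 2))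
        else 0) a := by
  have hu : Summable fun ρ : ZetaZeros.riemannZetaNontrivialZeros ↦
      5 * ((riemannZetaZeroOrder (ρ : ℂ) : ℝ) / (1 + (ρ : ℂ).im ^ 2)) :=
    summable_order_div_one_add_im_sq.mul_left 5
  refine hasDerivAt_tsum_of_isPreconnected hu isOpen_Ioo (convex_Ioo 0 1).isPreconnected
    (g := fun (ρ : ZetaZeros.riemannZetaNontrivialZeros) (a : ℝ) ↦
      if σ < (ρ : ℂ).re then
        (riemannZetaZeroOrder (ρ : ℂ) : ℝ) * Real.log (‖(ρ : ℂ) - σ + a‖ / ‖(ρ : ℂ) - σ - a‖)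
      else 0)
    (g' := fun (ρ : ZetaZeros.riemannZetaNontrivialZeros) (a : ℝ) ↦
      if σ < (ρ : ℂ).re then
        (riemannZetaZeroOrder (ρ : ℂ) : ℝ) *
          (((ρ : ℂ).re - σ + a) / (((ρ : ℂ).re - σ + a) ^ 2 + (ρ : ℂ).im ^ 2) +
            ((ρ : ℂ).re - σ - a) / (((ρ : ℂ).re - σ - a) ^ 2 + (ρ : ℂ).im ^ 2))
      else 0)
    (fun ρ y _ ↦ ?_) (fun ρ y hy ↦ ?_) (y₀ := 1 / 2) (by norm_num) ?_ ha
  · by_cases hlt : σ < (ρ : ℂ).re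
    · simp only [if_pos hlt]
      exact (hasDerivAt_log_norm_ratio
        (ZetaZeros.riemannZetaNontrivialZeros.im_ne_zero ρ.2) σ y).const_mul _
    · simp only [if_neg hlt]
      exact hasDerivAt_const y 0
  · by_cases hlt : σ < (ρ : ℂ).re
    · simp only [if_pos hlt, Real.norm_eq_abs]
      exact abs_zeroTerm_deriv_le ρ hσ hlt hy
    · simp only [if_neg hlt, norm_zero]
      have hm0 : (0 : ℝ) ≤ riemannZetaZeroOrder (ρ : ℂ) := order_nonneg ρ
      positivity
  · exact summable_zeroTerm hσ (by norm_num : (0 : ℝ) < 1 / 2)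

/-- Summability of the first-derivative series (`1/2 ≤ σ`, `0 < a < 1`). [folklore] -/
private theorem summable_zeroTerm_deriv {σ : ℝ} (hσ : 1 / 2 ≤ σ) {a : ℝ} (ha : a ∈ Ioo (0 : ℝ) 1) :
    Summable fun ρ : ZetaZeros.riemannZetaNontrivialZeros ↦
      if σ < (ρ : ℂ).re then
        (riemannZetaZeroOrder (ρ : ℂ) : ℝ) *
          (((ρ : ℂ).re - σ + a) / (((ρ : ℂ).re - σ + a) ^ 2 + (ρ : ℂ).im ^ 2) +
            ((ρ : ℂ).re - σ - a) / (((ρ : ℂ).re - σ - a) ^ 2 + (ρ : ℂ).im ^ 2))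
      else 0 := by
  refine Summable.of_norm_bounded (summable_order_div_one_add_im_sq.mul_left 5) fun ρ ↦ ?_
  by_cases hlt : σ < (ρ : ℂ).re
  · simp only [if_pos hlt, Real.norm_eq_abs]
    exact abs_zeroTerm_deriv_le ρ hσ hlt ha
  · simp only [if_neg hlt, norm_zero]
    have hm0 : (0 : ℝ) ≤ riemannZetaZeroOrder (ρ : ℂ) := order_nonneg ρ
    positivity

/-- Summability of the second-derivative series (any `σ`, `a`). [folklore] -/
private theorem summable_zeroTerm_deriv_two (σ a : ℝ) :
    Summable fun ρ : ZetaZeros.riemannZetaNontrivialZeros ↦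
      if σ < (ρ : ℂ).re then
        (riemannZetaZeroOrder (ρ : ℂ) : ℝ) *
          (((ρ : ℂ).im ^ 2 - ((ρ : ℂ).re - σ + a) ^ 2) / (((ρ : ℂ).re - σ + a) ^ 2 + (ρ : ℂ).im ^ 2) ^ 2 -
            ((ρ : ℂ).im ^ 2 - ((ρ : ℂ).re - σ - a) ^ 2) /
              (((ρ : ℂ).re - σ - a) ^ 2 + (ρ : ℂ).im ^ 2) ^ 2)
      else 0 := by
  refine Summable.of_norm_bounded (summable_order_div_one_add_im_sq.mul_left 4) fun ρ ↦ ?_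
  by_cases hlt : σ < (ρ : ℂ).re
  · simp only [if_pos hlt, Real.norm_eq_abs]
    exact abs_zeroTerm_deriv_two_le ρ σ a
  · simp only [if_neg hlt, norm_zero]
    have hm0 : (0 : ℝ) ≤ riemannZetaZeroOrder (ρ : ℂ) := order_nonneg ρ
    positivity

/-- **Term-wise differentiation of the zero sum, second derivative** (`1/2 ≤ σ < 1`,
`0 < a < 1`). [folklore] -/
private theorem hasDerivAt_zeroSum_deriv {σ : ℝ} (hσ : 1 / 2 ≤ σ) {a : ℝ}
    (ha : a ∈ Ioo (0 : ℝ) 1) :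
    HasDerivAt
      (fun a : ℝ ↦ ∑' ρ : ZetaZeros.riemannZetaNontrivialZeros,
        if σ < (ρ : ℂ).re then
          (riemannZetaZeroOrder (ρ : ℂ) : ℝ) *
            (((ρ : ℂ).re - σ + a) / (((ρ : ℂ).re - σ + a) ^ 2 + (ρ : ℂ).im ^ 2) +
              ((ρ : ℂ).re - σ - a) / (((ρ : ℂ).re - σ - a) ^ 2 + (ρ : ℂ).im ^ 2))
        else 0)
      (∑' ρ : ZetaZeros.riemannZetaNontrivialZeros,
        if σ < (ρ : ℂ).re then
          (riemannZetaZeroOrder (ρ : ℂ) : ℝ) *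
            (((ρ : ℂ).im ^ 2 - ((ρ : ℂ).re - σ + a) ^ 2) /
                (((ρ : ℂ).re - σ + a) ^ 2 + (ρ : ℂ).im ^ 2) ^ 2 -
              ((ρ : ℂ).im ^ 2 - ((ρ : ℂ).re - σ - a) ^ 2) /
                (((ρ : ℂ).re - σ - a) ^ 2 + (ρ : ℂ).im ^ 2) ^ 2)
        else 0) a := by
  have hu : Summable fun ρ : ZetaZeros.riemannZetaNontrivialZeros ↦
      4 * ((riemannZetaZeroOrder (ρ : ℂ) : ℝ) / (1 + (ρ : ℂ).im ^ 2)) :=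
    summable_order_div_one_add_im_sq.mul_left 4
  refine hasDerivAt_tsum_of_isPreconnected hu isOpen_Ioo (convex_Ioo 0 1).isPreconnected
    (g := fun (ρ : ZetaZeros.riemannZetaNontrivialZeros) (a : ℝ) ↦
      if σ < (ρ : ℂ).re then
        (riemannZetaZeroOrder (ρ : ℂ) : ℝ) *
          (((ρ : ℂ).re - σ + a) / (((ρ : ℂ).re - σ + a) ^ 2 + (ρ : ℂ).im ^ 2) +
            ((ρ : ℂ).re - σ - a) / (((ρ : ℂ).re - σ - a) ^ 2 + (ρ : ℂ).im ^ 2))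
      else 0)
    (g' := fun (ρ : ZetaZeros.riemannZetaNontrivialZeros) (a : ℝ) ↦
      if σ < (ρ : ℂ).re then
        (riemannZetaZeroOrder (ρ : ℂ) : ℝ) *
          (((ρ : ℂ).im ^ 2 - ((ρ : ℂ).re - σ + a) ^ 2) /
              (((ρ : ℂ).re - σ + a) ^ 2 + (ρ : ℂ).im ^ 2) ^ 2 -
            ((ρ : ℂ).im ^ 2 - ((ρ : ℂ).re - σ - a) ^ 2) /
              (((ρ : ℂ).re - σ - a) ^ 2 + (ρ : ℂ).im ^ 2) ^ 2)
      else 0)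
    (fun ρ y _ ↦ ?_) (fun ρ y _ ↦ ?_) (y₀ := 1 / 2) (by norm_num) ?_ ha
  · by_cases hlt : σ < (ρ : ℂ).re
    · simp only [if_pos hlt]
      exact (hasDerivAt_log_norm_ratio_deriv
        (ZetaZeros.riemannZetaNontrivialZeros.im_ne_zero ρ.2) σ y).const_mul _
    · simp only [if_neg hlt]
      exact hasDerivAt_const y 0
  · by_cases hlt : σ < (ρ : ℂ).re
    · simp only [if_pos hlt, Real.norm_eq_abs]
      exact abs_zeroTerm_deriv_two_le ρ σ y
    · simp only [if_neg hlt, norm_zero]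
      have hm0 : (0 : ℝ) ≤ riemannZetaZeroOrder (ρ : ℂ) := order_nonneg ρ
      positivity
  · exact summable_zeroTerm_deriv hσ (a := 1 / 2) (by norm_num)

/-! ### §6 The elementary part `e(σ,a) = log|ζ₁(a+σ)| − log(a + |1−σ|)` and its `a`-derivatives -/

/-- `d/du log|ζ₁(u)| = Re(ζ₁'/ζ₁)(u)` for real `u > 0`. [folklore] -/
private theorem hasDerivAt_log_norm_zeta₁ {u : ℝ} (hu : 0 < u) :
    HasDerivAt (fun u : ℝ ↦ Real.log ‖riemannZeta₁ (u : ℂ)‖)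
      ((deriv riemannZeta₁ (u : ℂ) / riemannZeta₁ (u : ℂ)).re) u := by
  have h := hasDerivAt_log_norm_comp_horizontal (g := riemannZeta₁) (x := u) (y := 0)
    (by simpa using (differentiable_riemannZeta₁.analyticAt ((u : ℂ))))
    (by simpa using riemannZeta₁_ofReal_ne_zero' hu)
  simpa using h

/-- `ζ₁'/ζ₁` is analytic at the real points `u > 0`. [folklore] -/
private theorem analyticAt_logDeriv_zeta₁ {u : ℝ} (hu : 0 < u) :
    AnalyticAt ℂ (fun z : ℂ ↦ deriv riemannZeta₁ z / riemannZeta₁ z) (u : ℂ) :=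
  ((differentiable_riemannZeta₁.analyticAt (u : ℂ)).deriv).div
    (differentiable_riemannZeta₁.analyticAt (u : ℂ)) (riemannZeta₁_ofReal_ne_zero' hu)

/-- `d/du Re(ζ₁'/ζ₁)(u) = Re((ζ₁'/ζ₁)'(u))` for real `u > 0`. [folklore] -/
private theorem hasDerivAt_re_logDeriv_zeta₁ {u : ℝ} (hu : 0 < u) :
    HasDerivAt (fun u : ℝ ↦ (deriv riemannZeta₁ (u : ℂ) / riemannZeta₁ (u : ℂ)).re)
      ((deriv (fun z : ℂ ↦ deriv riemannZeta₁ z / riemannZeta₁ z) (u : ℂ)).re) u := by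
  have hG : HasDerivAt (fun u : ℝ ↦ deriv riemannZeta₁ (u : ℂ) / riemannZeta₁ (u : ℂ))
      (deriv (fun z : ℂ ↦ deriv riemannZeta₁ z / riemannZeta₁ z) (u : ℂ)) u := by
    have h := (analyticAt_logDeriv_zeta₁ hu).differentiableAt.hasDerivAt
    simpa using h.comp_ofReal
  exact Complex.reCLM.hasFDerivAt.comp_hasDerivAt u hG

/-- The elementary part is twice differentiable in `a` with the stated first derivative
(`σ ≥ 1/2`, `a > 0`). [folklore] -/
private theorem hasDerivAt_elem {σ : ℝ} (hσ : 1 / 2 ≤ σ) {a : ℝ} (ha : 0 < a) :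
    HasDerivAt (fun a : ℝ ↦ Real.log ‖riemannZeta₁ ((a + σ : ℝ) : ℂ)‖ - Real.log (a + |1 - σ|))
      ((deriv riemannZeta₁ ((a + σ : ℝ) : ℂ) / riemannZeta₁ ((a + σ : ℝ) : ℂ)).re -
        1 / (a + |1 - σ|)) a := by
  have hu : 0 < a + σ := by linarith
  have h1 : HasDerivAt (fun a : ℝ ↦ Real.log ‖riemannZeta₁ ((a + σ : ℝ) : ℂ)‖)
      ((deriv riemannZeta₁ ((a + σ : ℝ) : ℂ) / riemannZeta₁ ((a + σ : ℝ) : ℂ)).re * 1) a := by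
    have := (hasDerivAt_log_norm_zeta₁ hu).comp a ((hasDerivAt_id a).add_const σ)
    simpa [Function.comp_def] using this
  have hpos : 0 < a + |1 - σ| := by positivity
  have h2 : HasDerivAt (fun a : ℝ ↦ Real.log (a + |1 - σ|)) (1 / (a + |1 - σ|)) a := by
    have := ((hasDerivAt_id a).add_const |1 - σ|).log hpos.ne'
    simpa using this
  have := h1.fun_sub h2
  simpa using this

/-- Second `a`-derivative of the elementary part (`σ ≥ 1/2`, `a > 0`). [folklore] -/
private theorem hasDerivAt_elem_deriv {σ : ℝ} (hσ : 1 / 2 ≤ σ) {a : ℝ} (ha : 0 < a) :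
    HasDerivAt
      (fun a : ℝ ↦ (deriv riemannZeta₁ ((a + σ : ℝ) : ℂ) / riemannZeta₁ ((a + σ : ℝ) : ℂ)).re -
        1 / (a + |1 - σ|))
      ((deriv (fun z : ℂ ↦ deriv riemannZeta₁ z / riemannZeta₁ z) ((a + σ : ℝ) : ℂ)).re +
        1 / (a + |1 - σ|) ^ 2) a := by
  have hu : 0 < a + σ := by linarith
  have h1 : HasDerivAt
      (fun a : ℝ ↦ (deriv riemannZeta₁ ((a + σ : ℝ) : ℂ) / riemannZeta₁ ((a + σ : ℝ) : ℂ)).re)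
      ((deriv (fun z : ℂ ↦ deriv riemannZeta₁ z / riemannZeta₁ z) ((a + σ : ℝ) : ℂ)).re * 1) a := by
    have := (hasDerivAt_re_logDeriv_zeta₁ hu).comp a ((hasDerivAt_id a).add_const σ)
    simpa [Function.comp_def] using this
  have hpos : 0 < a + |1 - σ| := by positivity
  have h2 : HasDerivAt (fun a : ℝ ↦ 1 / (a + |1 - σ|)) (-(1 / (a + |1 - σ|) ^ 2)) a := by
    have := (hasDerivAt_const a (1 : ℝ)).fun_div ((hasDerivAt_id a).add_const |1 - σ|) hpos.ne'
    refine (this.congr_deriv ?_)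
    simp only [id]
    field_simp
    ring
  have := h1.fun_sub h2
  simpa using this

/-! ### §7 The Poisson mean as elementary part plus zero sum, and Volchkov's integrand in `σ`

For `σ ∈ [1/2, 1) ∪ (1, ∞)` and `0 < a < 1`:
`∫ log|ζ(σ+it)| a/(a²+t²) dt = π·(e(σ,a) + Σ_ρ T(ρ,σ,a))`; differentiating twice at `a = 1/2`:
`∫₀^∞ (1−12t²)/(1+4t²)³ log|ζ(σ+it)| dt = (π/32)·(E(σ) + S₂(σ))`. -/

/-- **The Poisson mean equals `π·(elementary part + zero sum)`** for `σ ≥ 1/2`, `σ ≠ 1`,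
`0 < a`. [cite: SekatskiiBeltraminelliMerlini2012, Thm. 3 with zero sum (σ < 1); §2 (σ > 1)] -/
theorem poissonMean_eq {σ : ℝ} (hσ : 1 / 2 ≤ σ) (hσ1 : σ ≠ 1) {a : ℝ} (ha : 0 < a) :
    ∫ t : ℝ, Real.log ‖riemannZeta (σ + t * I)‖ * (a / (a ^ 2 + t ^ 2)) =
      π * ((Real.log ‖riemannZeta₁ ((a + σ : ℝ) : ℂ)‖ - Real.log (a + |1 - σ|)) +
        ∑' ρ : ZetaZeros.riemannZetaNontrivialZeros,
          if σ < (ρ : ℂ).re then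
            (riemannZetaZeroOrder (ρ : ℂ) : ℝ) *
              Real.log (‖(ρ : ℂ) - σ + a‖ / ‖(ρ : ℂ) - σ - a‖)
          else 0) := by
  have hH : ∫ t : ℝ, Real.log ‖riemannZeta (σ + t * I)‖ * (a / (a ^ 2 + t ^ 2)) =
      π * sbmPoissonLogIntegral a σ := by
    unfold sbmPoissonLogIntegral
    rw [← integral_const_mul, ← integral_const_mul]
    refine integral_congr_ae (ae_of_all _ fun t ↦ ?_)
    have hπ : (π : ℝ) ≠ 0 := Real.pi_pos.ne'
    field_simp
  rw [hH]
  rcases lt_or_gt_of_ne hσ1 with hlt | hgt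
  · have h := (hasSum_zeroTerm hσ hlt ha).tsum_eq
    rw [h, show |1 - σ| = 1 - σ from abs_of_pos (by linarith)]
    ring
  · have hval := (sbm_poisson_of_one_lt ha hgt).2
    have hz := zeroSum_eq_zero_of_one_le hgt.le (fun ρ : ZetaZeros.riemannZetaNontrivialZeros ↦
      (riemannZetaZeroOrder (ρ : ℂ) : ℝ) * Real.log (‖(ρ : ℂ) - σ + a‖ / ‖(ρ : ℂ) - σ - a‖))
    rw [hz, add_zero, hval,
      show |1 - σ| = σ - 1 from by rw [abs_sub_comm]; exact abs_of_pos (by linarith)]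
    have hne1 : ((a + σ : ℝ) : ℂ) ≠ 1 := by
      intro h
      have := congrArg Complex.re h
      simp at this
      linarith
    have hβ : 0 < a + σ - 1 := by linarith
    have hζ : riemannZeta ((a + σ : ℝ) : ℂ) ≠ 0 :=
      riemannZeta_ne_zero_of_one_le_re (by simp; linarith)
    rw [riemannZeta₁_eq_mul hne1, norm_mul,
      show ((a + σ : ℝ) : ℂ) - 1 = ((a + σ - 1 : ℝ) : ℂ) by push_cast; ring, Complex.norm_real,
      Real.norm_of_nonneg hβ.le, Real.log_mul hβ.ne' (norm_ne_zero_iff.2 hζ),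
      show a + (σ - 1) = a + σ - 1 by ring]
    ring

/-- **First derivative matching**: for `σ ≥ 1/2`, `σ ≠ 1`, `1/4 < a < 1`:
`∫ log|ζ(σ+it)| (t²−a²)/(a²+t²)² dt = π·(e₁(σ,a) + S₁(σ,a))`. [folklore] -/
private theorem poissonMean_deriv_eq {σ : ℝ} (hσ : 1 / 2 ≤ σ) (hσ1 : σ ≠ 1) {a : ℝ} (ha : 1 / 4 < a)
    (ha1 : a < 1) :
    ∫ t : ℝ, Real.log ‖riemannZeta (σ + t * I)‖ * ((t ^ 2 - a ^ 2) / (a ^ 2 + t ^ 2) ^ 2) =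
      π * (((deriv riemannZeta₁ ((a + σ : ℝ) : ℂ) / riemannZeta₁ ((a + σ : ℝ) : ℂ)).re -
          1 / (a + |1 - σ|)) +
        ∑' ρ : ZetaZeros.riemannZetaNontrivialZeros,
          if σ < (ρ : ℂ).re then
            (riemannZetaZeroOrder (ρ : ℂ) : ℝ) *
              (((ρ : ℂ).re - σ + a) / (((ρ : ℂ).re - σ + a) ^ 2 + (ρ : ℂ).im ^ 2) +
                ((ρ : ℂ).re - σ - a) / (((ρ : ℂ).re - σ - a) ^ 2 + (ρ : ℂ).im ^ 2))
          else 0) := by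
  have ha0 : 0 < a := by linarith
  have hD1 := hasDerivAt_poissonMean hσ hσ1 ha ha1
  -- the right side's derivative
  have hD2 : HasDerivAt
      (fun a : ℝ ↦ π * ((Real.log ‖riemannZeta₁ ((a + σ : ℝ) : ℂ)‖ - Real.log (a + |1 - σ|)) +
        ∑' ρ : ZetaZeros.riemannZetaNontrivialZeros,
          if σ < (ρ : ℂ).re then
            (riemannZetaZeroOrder (ρ : ℂ) : ℝ) *
              Real.log (‖(ρ : ℂ) - σ + a‖ / ‖(ρ : ℂ) - σ - a‖)
          else 0))
      (π * (((deriv riemannZeta₁ ((a + σ : ℝ) : ℂ) / riemannZeta₁ ((a + σ : ℝ) : ℂ)).re -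
          1 / (a + |1 - σ|)) +
        ∑' ρ : ZetaZeros.riemannZetaNontrivialZeros,
          if σ < (ρ : ℂ).re then
            (riemannZetaZeroOrder (ρ : ℂ) : ℝ) *
              (((ρ : ℂ).re - σ + a) / (((ρ : ℂ).re - σ + a) ^ 2 + (ρ : ℂ).im ^ 2) +
                ((ρ : ℂ).re - σ - a) / (((ρ : ℂ).re - σ - a) ^ 2 + (ρ : ℂ).im ^ 2))
          else 0)) a :=
    ((hasDerivAt_elem hσ ha0).fun_add (hasDerivAt_zeroSum hσ ⟨ha0, ha1⟩)).const_mul π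
  -- the two functions agree on the neighbourhood `(0, 1)` of `a`
  have heq : (fun a : ℝ ↦ ∫ t : ℝ, Real.log ‖riemannZeta (σ + t * I)‖ * (a / (a ^ 2 + t ^ 2))) =ᶠ[𝓝 a]
      (fun a : ℝ ↦ π * ((Real.log ‖riemannZeta₁ ((a + σ : ℝ) : ℂ)‖ - Real.log (a + |1 - σ|)) +
        ∑' ρ : ZetaZeros.riemannZetaNontrivialZeros,
          if σ < (ρ : ℂ).re then
            (riemannZetaZeroOrder (ρ : ℂ) : ℝ) *
              Real.log (‖(ρ : ℂ) - σ + a‖ / ‖(ρ : ℂ) - σ - a‖)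
          else 0)) := by
    filter_upwards [Ioi_mem_nhds ha0] with x hx
    exact poissonMean_eq hσ hσ1 hx
  exact hD1.unique (hD2.congr_of_eventuallyEq heq)

/-- **Volchkov's integrand in `σ` as elementary part plus zero sum** (RH-free): for `σ ≥ 1/2`,
`σ ≠ 1`,
`∫₀^∞ (1−12t²)/(1+4t²)³ log|ζ(σ+it)| dt = (π/32)·(Re (ζ₁'/ζ₁)'(σ+1/2) + (1/2+|1−σ|)^{−2} + S₂(σ))`,
`S₂(σ) = Σ_{Re ρ>σ} m(ρ)[q'(β−σ+½) − q'(β−σ−½)]`, `q'(x) = (γ²−x²)/(x²+γ²)²`.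
[cite: Volchkov1995, the equality (zero-free value of the inner mechanism); SekatskiiBeltraminelliMerlini2012, Thm. 5a/Remark 2] -/
theorem integral_weight_logZeta_eq {σ : ℝ} (hσ : 1 / 2 ≤ σ) (hσ1 : σ ≠ 1) :
    ∫ t in Ioi (0 : ℝ), (1 - 12 * t ^ 2) / (1 + 4 * t ^ 2) ^ 3 * Real.log ‖riemannZeta (σ + t * I)‖ =
      π / 32 * ((deriv (fun z : ℂ ↦ deriv riemannZeta₁ z / riemannZeta₁ z)
          ((1 / 2 + σ : ℝ) : ℂ)).re + 1 / (1 / 2 + |1 - σ|) ^ 2 +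
        ∑' ρ : ZetaZeros.riemannZetaNontrivialZeros,
          if σ < (ρ : ℂ).re then
            (riemannZetaZeroOrder (ρ : ℂ) : ℝ) *
              (((ρ : ℂ).im ^ 2 - ((ρ : ℂ).re - σ + 1 / 2) ^ 2) /
                  (((ρ : ℂ).re - σ + 1 / 2) ^ 2 + (ρ : ℂ).im ^ 2) ^ 2 -
                ((ρ : ℂ).im ^ 2 - ((ρ : ℂ).re - σ - 1 / 2) ^ 2) /
                  (((ρ : ℂ).re - σ - 1 / 2) ^ 2 + (ρ : ℂ).im ^ 2) ^ 2)
          else 0) := by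
  have hhalf : (1 / 2 : ℝ) ∈ Ioo (1 / 4 : ℝ) 1 := by norm_num
  have hD1 := hasDerivAt_poissonMean_deriv hσ hσ1 hhalf.1 hhalf.2
  have hD2 : HasDerivAt
      (fun a : ℝ ↦ π * (((deriv riemannZeta₁ ((a + σ : ℝ) : ℂ) / riemannZeta₁ ((a + σ : ℝ) : ℂ)).re -
          1 / (a + |1 - σ|)) +
        ∑' ρ : ZetaZeros.riemannZetaNontrivialZeros,
          if σ < (ρ : ℂ).re then
            (riemannZetaZeroOrder (ρ : ℂ) : ℝ) *
              (((ρ : ℂ).re - σ + a) / (((ρ : ℂ).re - σ + a) ^ 2 + (ρ : ℂ).im ^ 2) +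
                ((ρ : ℂ).re - σ - a) / (((ρ : ℂ).re - σ - a) ^ 2 + (ρ : ℂ).im ^ 2))
          else 0))
      (π * (((deriv (fun z : ℂ ↦ deriv riemannZeta₁ z / riemannZeta₁ z)
          ((1 / 2 + σ : ℝ) : ℂ)).re + 1 / (1 / 2 + |1 - σ|) ^ 2) +
        ∑' ρ : ZetaZeros.riemannZetaNontrivialZeros,
          if σ < (ρ : ℂ).re then
            (riemannZetaZeroOrder (ρ : ℂ) : ℝ) *
              (((ρ : ℂ).im ^ 2 - ((ρ : ℂ).re - σ + 1 / 2) ^ 2) /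
                  (((ρ : ℂ).re - σ + 1 / 2) ^ 2 + (ρ : ℂ).im ^ 2) ^ 2 -
                ((ρ : ℂ).im ^ 2 - ((ρ : ℂ).re - σ - 1 / 2) ^ 2) /
                  (((ρ : ℂ).re - σ - 1 / 2) ^ 2 + (ρ : ℂ).im ^ 2) ^ 2)
          else 0)) (1 / 2) :=
    ((hasDerivAt_elem_deriv hσ (by norm_num : (0 : ℝ) < 1 / 2)).fun_add
      (hasDerivAt_zeroSum_deriv hσ (a := 1 / 2) (by norm_num))).const_mul π
  have heq : (fun a : ℝ ↦ ∫ t : ℝ, Real.log ‖riemannZeta (σ + t * I)‖ *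
      ((t ^ 2 - a ^ 2) / (a ^ 2 + t ^ 2) ^ 2)) =ᶠ[𝓝 (1 / 2 : ℝ)]
      (fun a : ℝ ↦ π * (((deriv riemannZeta₁ ((a + σ : ℝ) : ℂ) / riemannZeta₁ ((a + σ : ℝ) : ℂ)).re -
          1 / (a + |1 - σ|)) +
        ∑' ρ : ZetaZeros.riemannZetaNontrivialZeros,
          if σ < (ρ : ℂ).re then
            (riemannZetaZeroOrder (ρ : ℂ) : ℝ) *
              (((ρ : ℂ).re - σ + a) / (((ρ : ℂ).re - σ + a) ^ 2 + (ρ : ℂ).im ^ 2) +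
                ((ρ : ℂ).re - σ - a) / (((ρ : ℂ).re - σ - a) ^ 2 + (ρ : ℂ).im ^ 2))
          else 0)) := by
    filter_upwards [Ioo_mem_nhds hhalf.1 hhalf.2] with x hx
    exact poissonMean_deriv_eq hσ hσ1 hx.1 hx.2
  have hval := hD1.unique (hD2.congr_of_eventuallyEq heq)
  rw [integral_logZeta_mul_poisson_deriv_two_half σ] at hval
  have h32 : (32 : ℝ) ≠ 0 := by norm_num
  calc _ = (1 / 32 : ℝ) * (32 * ∫ t in Ioi (0 : ℝ), (1 - 12 * t ^ 2) / (1 + 4 * t ^ 2) ^ 3 *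
        Real.log ‖riemannZeta (σ + t * I)‖) := by ring
    _ = _ := by rw [hval]; ring

/-! ### §8 The elementary part integrates to `3 − γ` over `σ ∈ (1/2, ∞)`

`∫_{1/2}^∞ Re (ζ₁'/ζ₁)'(σ+1/2) dσ = lim_{u→∞} Re ζ₁'/ζ₁(u) − Re ζ₁'/ζ₁(1) = 0 − γ` (Mathlib's
`deriv_riemannZeta₁_one`), and `∫_{1/2}^∞ (1/2+|1−σ|)^{−2} dσ = 1 + 2 = 3`. The integrability of
`(ζ₁'/ζ₁)'` on `[2, ∞)` is obtained from `(ζ₁'/ζ₁)' = (ζ'/ζ)' − 1/(s−1)²` and the SIGN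
`(ζ'/ζ)'(u) = Σ Λ(n) log n · n^{−u} ≥ 0` for real `u > 1` (a monotone function with a limit has an
integrable derivative). -/

/-- `ζ₁'/ζ₁ = 1/(s−1) + ζ'/ζ` away from `s = 1` and the zeros of `ζ`. [folklore] -/
private theorem logDeriv_zeta₁_eq {s : ℂ} (hs : s ≠ 1) (hζ : riemannZeta s ≠ 0) :
    deriv riemannZeta₁ s / riemannZeta₁ s = 1 / (s - 1) + deriv riemannZeta s / riemannZeta s := by
  have hev : riemannZeta₁ =ᶠ[𝓝 s] fun z ↦ (z - 1) * riemannZeta z := by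
    filter_upwards [isOpen_ne.mem_nhds hs] with z hz
    exact riemannZeta₁_eq_mul hz
  have hd : HasDerivAt (fun z : ℂ ↦ (z - 1) * riemannZeta z)
      (1 * riemannZeta s + (s - 1) * deriv riemannZeta s) s :=
    ((hasDerivAt_id s).sub_const 1).mul (differentiableAt_riemannZeta hs).hasDerivAt
  rw [hev.deriv_eq, hd.deriv, riemannZeta₁_eq_mul hs]
  have hs1 : s - 1 ≠ 0 := sub_ne_zero.2 hs
  field_simp

/-- `ζ` is analytic at every `u ≠ 1` (tree: `analyticOn_riemannZeta`). [folklore] -/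
private theorem analyticAt_zeta {u : ℂ} (hu : u ≠ 1) : AnalyticAt ℂ riemannZeta u :=
  analyticOn_riemannZeta u hu

/-- `(ζ₁'/ζ₁)'(u) = (ζ'/ζ)'(u) − 1/(u−1)²` at points `u ≠ 1` with `ζ(u) ≠ 0`. [folklore] -/
private theorem deriv_logDeriv_zeta₁_eq {u : ℂ} (hu : u ≠ 1) (hζ : riemannZeta u ≠ 0) :
    deriv (fun z : ℂ ↦ deriv riemannZeta₁ z / riemannZeta₁ z) u =
      deriv (fun z : ℂ ↦ deriv riemannZeta z / riemannZeta z) u - 1 / (u - 1) ^ 2 := by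
  -- the two functions agree near `u`
  have hopen : IsOpen {z : ℂ | z ≠ 1 ∧ riemannZeta z ≠ 0} := by
    rw [isOpen_iff_mem_nhds]
    rintro z ⟨hz1, hz0⟩
    have hc : ContinuousAt riemannZeta z := (differentiableAt_riemannZeta hz1).continuousAt
    filter_upwards [isOpen_ne.mem_nhds hz1, hc.preimage_mem_nhds (isOpen_ne.mem_nhds hz0)]
      with w hw1 hw0
    exact ⟨hw1, hw0⟩
  have hev : (fun z : ℂ ↦ deriv riemannZeta₁ z / riemannZeta₁ z) =ᶠ[𝓝 u]
      fun z ↦ 1 / (z - 1) + deriv riemannZeta z / riemannZeta z := by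
    filter_upwards [hopen.mem_nhds ⟨hu, hζ⟩] with z hz
    exact logDeriv_zeta₁_eq hz.1 hz.2
  rw [hev.deriv_eq]
  have hu1 : u - 1 ≠ 0 := sub_ne_zero.2 hu
  have hd1 : HasDerivAt (fun z : ℂ ↦ 1 / (z - 1)) (-(1 / (u - 1) ^ 2)) u := by
    have := (hasDerivAt_const u (1 : ℂ)).fun_div ((hasDerivAt_id u).sub_const 1) hu1
    refine this.congr_deriv ?_
    simp only [id]
    field_simp
    ring
  have hdiff : DifferentiableAt ℂ (fun z : ℂ ↦ deriv riemannZeta z / riemannZeta z) u :=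
    (((analyticAt_zeta hu).deriv).div (analyticAt_zeta hu) hζ).differentiableAt
  rw [(hd1.fun_add hdiff.hasDerivAt).deriv]
  ring

/-- `ζ'/ζ(u) → 0` as `u → +∞` along the reals (`|ζ'/ζ(u)| ≤ 2^{2−u}·Σ Λ(n)/n²` for `u ≥ 2`).
[folklore] -/
private theorem tendsto_logDeriv_zeta_atTop :
    Tendsto (fun u : ℝ ↦ deriv riemannZeta (u : ℂ) / riemannZeta (u : ℂ)) atTop (𝓝 0) := by
  set C : ℝ := ∑' n : ℕ, ‖LSeries.term (fun n ↦ (ArithmeticFunction.vonMangoldt n : ℂ)) 2 n‖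
    with hC
  have hbound : ∀ u : ℝ, 2 ≤ u →
      ‖deriv riemannZeta (u : ℂ) / riemannZeta (u : ℂ)‖ ≤ (2 : ℝ) ^ (2 - u) * C := by
    intro u hu
    have h := norm_logDeriv_riemannZeta_le_of_two_le_re (s := (u : ℂ)) (by simpa using hu)
    simpa [hC] using h
  have hlim : Tendsto (fun u : ℝ ↦ (2 : ℝ) ^ (2 - u) * C) atTop (𝓝 0) := by
    have h1 : Tendsto (fun u : ℝ ↦ (2 : ℝ) ^ (2 - u)) atTop (𝓝 0) := by
      have h2 : Tendsto (fun u : ℝ ↦ 2 - u) atTop atBot := by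
        have h3 := tendsto_atBot_add_const_left atTop (2 : ℝ) tendsto_neg_atTop_atBot
        exact h3.congr fun u ↦ by ring
      exact (tendsto_rpow_atBot_of_base_gt_one 2 (by norm_num)).comp h2
    simpa using h1.mul_const C
  refine squeeze_zero_norm' ?_ hlim
  filter_upwards [eventually_ge_atTop (2 : ℝ)] with u hu
  exact hbound u hu

/-- `Re ζ₁'/ζ₁(u) → 0` as `u → +∞` along the reals. [folklore] -/
private theorem tendsto_re_logDeriv_zeta₁_atTop :
    Tendsto (fun u : ℝ ↦ (deriv riemannZeta₁ (u : ℂ) / riemannZeta₁ (u : ℂ)).re) atTop (𝓝 0) := by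
  have h1 : Tendsto (fun u : ℝ ↦ (1 : ℂ) / ((u : ℂ) - 1)) atTop (𝓝 0) := by
    have h : Tendsto (fun u : ℝ ↦ ((u : ℂ) - 1)) atTop (Bornology.cobounded ℂ) := by
      rw [tendsto_norm_atTop_iff_cobounded.symm]
      have : Tendsto (fun u : ℝ ↦ u - 1) atTop atTop := tendsto_atTop_add_const_right _ _ tendsto_id
      refine tendsto_atTop_mono' _ ?_ this
      filter_upwards [eventually_ge_atTop (1 : ℝ)] with u hu
      have : ((u : ℂ) - 1) = ((u - 1 : ℝ) : ℂ) := by push_cast; ring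
      rw [this, Complex.norm_real, Real.norm_of_nonneg (by linarith)]
    simpa [Function.comp_def] using (tendsto_inv₀_cobounded.comp h)
  have h2 := h1.add tendsto_logDeriv_zeta_atTop
  rw [add_zero] at h2
  have h3 : Tendsto (fun u : ℝ ↦ deriv riemannZeta₁ (u : ℂ) / riemannZeta₁ (u : ℂ)) atTop (𝓝 0) := by
    refine h2.congr' ?_
    filter_upwards [eventually_ge_atTop (2 : ℝ)] with u hu
    have hu1 : (u : ℂ) ≠ 1 := by
      intro h; have := congrArg Complex.re h; simp at this; linarith
    rw [logDeriv_zeta₁_eq hu1 (riemannZeta_ne_zero_of_one_le_re (by simp; linarith))]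
  simpa [Function.comp_def] using (Complex.continuous_re.tendsto 0).comp h3

/-- **Positivity of `(ζ'/ζ)'` on the real axis beyond `1`**: for real `u > 1`,
`Re (ζ'/ζ)'(u) = Σ_n Λ(n) log n · n^{−u} ≥ 0` (the Dirichlet series of `−ζ'/ζ` is `Σ Λ(n) n^{−s}`,
Mathlib `LSeries_vonMangoldt_eq_deriv_riemannZeta_div`, differentiated term-wise, `LSeries_deriv`).
[folklore] -/
private theorem re_deriv_logDeriv_zeta_nonneg {u : ℝ} (hu : 1 < u) :
    0 ≤ (deriv (fun z : ℂ ↦ deriv riemannZeta z / riemannZeta z) (u : ℂ)).re := by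
  set Λ : ℕ → ℂ := fun n ↦ (ArithmeticFunction.vonMangoldt n : ℂ) with hΛ
  have habs : LSeries.abscissaOfAbsConv Λ ≤ 1 :=
    LSeries.abscissaOfAbsConv_le_of_forall_lt_LSeriesSummable fun y hy ↦
      ArithmeticFunction.LSeriesSummable_vonMangoldt (by simpa using hy)
  have hu' : LSeries.abscissaOfAbsConv Λ < ((u : ℂ)).re := by
    refine lt_of_le_of_lt habs ?_
    simpa using (show (1 : EReal) < (u : ℝ) by exact_mod_cast hu)
  -- `ζ'/ζ = −L Λ` near `u`
  have hev : (fun z : ℂ ↦ deriv riemannZeta z / riemannZeta z) =ᶠ[𝓝 (u : ℂ)] fun z ↦ -LSeries Λ z := by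
    have hopen : IsOpen {z : ℂ | 1 < z.re} := isOpen_lt continuous_const Complex.continuous_re
    filter_upwards [hopen.mem_nhds (by simpa using hu : 1 < ((u : ℂ)).re)] with z hz
    rw [ArithmeticFunction.LSeries_vonMangoldt_eq_deriv_riemannZeta_div hz]
    ring
  rw [hev.deriv_eq]
  change 0 ≤ (deriv (-(LSeries Λ)) (u : ℂ)).re
  rw [deriv.neg, LSeries_deriv hu', neg_neg]
  -- the L-series of `log · Λ` at the real point `u` has non-negative real terms
  have hsum : LSeriesSummable (LSeries.logMul Λ) (u : ℂ) := LSeriesSummable_logMul_of_lt_re hu'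
  rw [LSeries, Complex.re_tsum hsum]
  refine tsum_nonneg fun n ↦ ?_
  rcases Nat.eq_zero_or_pos n with hn | hn
  · simp [hn]
  · rw [LSeries.term_of_ne_zero hn.ne']
    have hn0 : (0 : ℝ) < n := by exact_mod_cast hn
    have e : LSeries.logMul Λ n / (n : ℂ) ^ (u : ℂ) =
        ((Real.log n * ArithmeticFunction.vonMangoldt n / (n : ℝ) ^ u : ℝ) : ℂ) := by
      simp only [LSeries.logMul, hΛ]
      rw [← Complex.ofReal_natCast, ← Complex.ofReal_log hn0.le, ← Complex.ofReal_cpow hn0.le]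
      push_cast
      ring
    rw [e, Complex.ofReal_re]
    exact div_nonneg (mul_nonneg (Real.log_natCast_nonneg n) ArithmeticFunction.vonMangoldt_nonneg)
      (Real.rpow_nonneg hn0.le u)

/-- Real derivative of `u ↦ Re g(u)` along the real axis for a complex-differentiable `g`.
[folklore] -/
private theorem hasDerivAt_re_comp_ofReal {g : ℂ → ℂ} {u : ℝ} (hg : DifferentiableAt ℂ g (u : ℂ)) :
    HasDerivAt (fun u : ℝ ↦ (g (u : ℂ)).re) ((deriv g (u : ℂ)).re) u := by
  have hG : HasDerivAt (fun u : ℝ ↦ g (u : ℂ)) (deriv g (u : ℂ)) u := by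
    simpa using hg.hasDerivAt.comp_ofReal
  exact Complex.reCLM.hasFDerivAt.comp_hasDerivAt u hG

/-- `F(σ) = Re ζ₁'/ζ₁(1/2+σ)` has derivative `Re (ζ₁'/ζ₁)'(1/2+σ)` for `σ > −1/2`. [folklore] -/
private theorem hasDerivAt_reLogDerivZeta₁_shift {σ : ℝ} (hσ : -1 / 2 < σ) :
    HasDerivAt
      (fun σ : ℝ ↦ (deriv riemannZeta₁ ((1 / 2 + σ : ℝ) : ℂ) / riemannZeta₁ ((1 / 2 + σ : ℝ) : ℂ)).re)
      ((deriv (fun z : ℂ ↦ deriv riemannZeta₁ z / riemannZeta₁ z) ((1 / 2 + σ : ℝ) : ℂ)).re) σ := by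
  have hu : 0 < 1 / 2 + σ := by linarith
  have := (hasDerivAt_re_logDeriv_zeta₁ hu).comp σ ((hasDerivAt_id σ).const_add (1 / 2))
  simpa [Function.comp_def] using this

/-- Continuity of `σ ↦ Re (ζ₁'/ζ₁)'(1/2+σ)` for `σ > −1/2`. [folklore] -/
private theorem continuousAt_reDerivLogDerivZeta₁_shift {σ : ℝ} (hσ : -1 / 2 < σ) :
    ContinuousAt
      (fun σ : ℝ ↦ (deriv (fun z : ℂ ↦ deriv riemannZeta₁ z / riemannZeta₁ z)
        ((1 / 2 + σ : ℝ) : ℂ)).re) σ := by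
  have hu : 0 < 1 / 2 + σ := by linarith
  have hA := (analyticAt_logDeriv_zeta₁ hu).deriv
  have hc : ContinuousAt (fun σ : ℝ ↦ (((1 / 2 + σ : ℝ) : ℂ))) σ := by fun_prop
  have h2 : ContinuousAt (fun σ : ℝ ↦ deriv (fun z : ℂ ↦ deriv riemannZeta₁ z / riemannZeta₁ z)
      ((1 / 2 + σ : ℝ) : ℂ)) σ :=
    ContinuousAt.comp (f := fun σ : ℝ ↦ (((1 / 2 + σ : ℝ) : ℂ))) (x := σ) hA.continuousAt hc
  exact Complex.continuous_re.continuousAt.comp h2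

/-- `∫_{σ>1} dσ/(σ−1/2)² = 2`, with integrability. [folklore] -/
private theorem integral_inv_sq_Ioi_one :
    IntegrableOn (fun σ : ℝ ↦ 1 / (σ - 1 / 2) ^ 2) (Ioi 1) ∧
      ∫ σ in Ioi (1 : ℝ), 1 / (σ - 1 / 2) ^ 2 = 2 := by
  have hderiv : ∀ x ∈ Ici (1 : ℝ), HasDerivAt (fun σ : ℝ ↦ -(σ - 1 / 2)⁻¹) (1 / (x - 1 / 2) ^ 2) x := by
    intro x hx
    have hx0 : x - 1 / 2 ≠ 0 := by have : (1 : ℝ) ≤ x := hx; linarith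
    have := (((hasDerivAt_id x).sub_const (1 / 2)).inv hx0).neg
    refine this.congr_deriv ?_
    simp only [id]
    field_simp
  have hpos : ∀ x ∈ Ioi (1 : ℝ), 0 ≤ 1 / (x - 1 / 2) ^ 2 := fun x _ ↦ by positivity
  have hlim : Tendsto (fun σ : ℝ ↦ -(σ - 1 / 2)⁻¹) atTop (𝓝 0) := by
    have h := tendsto_inv_atTop_zero.comp (tendsto_atTop_add_const_right atTop (-(1 / 2 : ℝ)) tendsto_id)
    have h' : Tendsto (fun σ : ℝ ↦ (σ - 1 / 2)⁻¹) atTop (𝓝 0) := by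
      refine h.congr fun σ ↦ ?_
      simp [sub_eq_add_neg]
    simpa using h'.neg
  refine ⟨integrableOn_Ioi_deriv_of_nonneg' hderiv hpos hlim, ?_⟩
  rw [integral_Ioi_of_hasDerivAt_of_nonneg' hderiv hpos hlim]
  norm_num

/-- `∫_{1/2}^1 dσ/(3/2−σ)² = 1`. [folklore] -/
private theorem integral_inv_sq_Ioc :
    ∫ σ in (1 / 2 : ℝ)..1, 1 / (3 / 2 - σ) ^ 2 = 1 := by
  have hderiv : ∀ x ∈ uIcc (1 / 2 : ℝ) 1, HasDerivAt (fun σ : ℝ ↦ (3 / 2 - σ)⁻¹)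
      (1 / (3 / 2 - x) ^ 2) x := by
    intro x hx
    rw [uIcc_of_le (by norm_num : (1 / 2 : ℝ) ≤ 1)] at hx
    have hx0 : 3 / 2 - x ≠ 0 := by linarith [hx.2]
    have := ((hasDerivAt_id x).const_sub (3 / 2)).inv hx0
    refine this.congr_deriv ?_
    simp only [id]
    field_simp
  have hint : IntervalIntegrable (fun x : ℝ ↦ 1 / (3 / 2 - x) ^ 2) volume (1 / 2) 1 := by
    refine ContinuousOn.intervalIntegrable fun x hx ↦ ?_
    rw [uIcc_of_le (by norm_num : (1 / 2 : ℝ) ≤ 1)] at hx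
    have hx0 : 3 / 2 - x ≠ 0 := by linarith [hx.2]
    exact ContinuousAt.continuousWithinAt (by
      have : ContinuousAt (fun x : ℝ ↦ (3 / 2 - x) ^ 2) x := by fun_prop
      exact (continuousAt_const.div this (pow_ne_zero 2 hx0)))
  rw [intervalIntegral.integral_eq_sub_of_hasDerivAt hderiv hint]
  norm_num

/-- **`∫_{σ>1/2} (1/2+|1−σ|)^{−2} dσ = 3`**, with integrability. [folklore] -/
private theorem integral_elemKernel :
    IntegrableOn (fun σ : ℝ ↦ 1 / (1 / 2 + |1 - σ|) ^ 2) (Ioi (1 / 2)) ∧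
      ∫ σ in Ioi (1 / 2 : ℝ), 1 / (1 / 2 + |1 - σ|) ^ 2 = 3 := by
  have hcont : Continuous fun σ : ℝ ↦ 1 / (1 / 2 + |1 - σ|) ^ 2 := by
    refine continuous_const.div (by fun_prop) fun σ ↦ ?_
    have : 0 < 1 / 2 + |1 - σ| := by positivity
    positivity
  obtain ⟨hI1, hv1⟩ := integral_inv_sq_Ioi_one
  -- on `(1, ∞)` the kernel is `1/(σ − 1/2)²`, on `[1/2, 1]` it is `1/(3/2 − σ)²`
  have hIoi : IntegrableOn (fun σ : ℝ ↦ 1 / (1 / 2 + |1 - σ|) ^ 2) (Ioi 1) := by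
    refine hI1.congr_fun (fun σ hσ ↦ ?_) measurableSet_Ioi
    have : (1 : ℝ) < σ := hσ
    rw [show |1 - σ| = σ - 1 by rw [abs_sub_comm]; exact abs_of_pos (by linarith)]
    ring
  have hvIoi : ∫ σ in Ioi (1 : ℝ), 1 / (1 / 2 + |1 - σ|) ^ 2 = 2 := by
    refine Eq.trans (setIntegral_congr_fun measurableSet_Ioi fun σ hσ ↦ ?_) hv1
    have : (1 : ℝ) < σ := hσ
    rw [show |1 - σ| = σ - 1 by rw [abs_sub_comm]; exact abs_of_pos (by linarith)]
    ring
  have hvIoc : ∫ σ in (1 / 2 : ℝ)..1, 1 / (1 / 2 + |1 - σ|) ^ 2 = 1 := by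
    refine Eq.trans (intervalIntegral.integral_congr fun σ hσ ↦ ?_) integral_inv_sq_Ioc
    rw [uIcc_of_le (by norm_num : (1 / 2 : ℝ) ≤ 1)] at hσ
    show 1 / (1 / 2 + |1 - σ|) ^ 2 = 1 / (3 / 2 - σ) ^ 2
    rw [abs_of_nonneg (by linarith [hσ.2])]
    ring
  constructor
  · rw [← Ioc_union_Ioi_eq_Ioi (by norm_num : (1 / 2 : ℝ) ≤ 1)]
    exact ((hcont.integrableOn_Icc (a := 1 / 2) (b := 1)).mono_set Ioc_subset_Icc_self).union hIoi
  · rw [← intervalIntegral.integral_interval_add_Ioi' (hcont.intervalIntegrable _ _) hIoi, hvIoi,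
      hvIoc]
    norm_num

/-- **Integrability of `σ ↦ Re (ζ₁'/ζ₁)'(1/2+σ)` on `(1/2, ∞)`**: continuous on `[1/2, 3/2]`; on
`(3/2, ∞)` it is `Re (ζ'/ζ)'(1/2+σ) − (σ−1/2)^{−2}` with `Re (ζ'/ζ)' ≥ 0` the derivative of a function
tending to `0`. [folklore] -/
private theorem integrableOn_reDerivLogDerivZeta₁ :
    IntegrableOn
      (fun σ : ℝ ↦ (deriv (fun z : ℂ ↦ deriv riemannZeta₁ z / riemannZeta₁ z)
        ((1 / 2 + σ : ℝ) : ℂ)).re) (Ioi (1 / 2)) := by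
  -- compact piece
  have hA : IntegrableOn
      (fun σ : ℝ ↦ (deriv (fun z : ℂ ↦ deriv riemannZeta₁ z / riemannZeta₁ z)
        ((1 / 2 + σ : ℝ) : ℂ)).re) (Ioc (1 / 2) (3 / 2)) := by
    refine (ContinuousOn.integrableOn_Icc fun σ hσ ↦ ?_).mono_set Ioc_subset_Icc_self
    exact (continuousAt_reDerivLogDerivZeta₁_shift (by linarith [hσ.1])).continuousWithinAt
  -- the piece `(3/2, ∞)`
  have hG : ∀ x : ℝ, 1 / 2 < x → HasDerivAt
      (fun σ : ℝ ↦ (deriv riemannZeta ((1 / 2 + σ : ℝ) : ℂ) / riemannZeta ((1 / 2 + σ : ℝ) : ℂ)).re)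
      ((deriv (fun z : ℂ ↦ deriv riemannZeta z / riemannZeta z) ((1 / 2 + x : ℝ) : ℂ)).re) x := by
    intro x hx
    have hu1 : ((1 / 2 + x : ℝ) : ℂ) ≠ 1 := by
      intro h; have := congrArg Complex.re h; simp at this; linarith
    have hζ : riemannZeta ((1 / 2 + x : ℝ) : ℂ) ≠ 0 :=
      riemannZeta_ne_zero_of_one_le_re (by simp; linarith)
    have hdiff : DifferentiableAt ℂ (fun z : ℂ ↦ deriv riemannZeta z / riemannZeta z)
        ((1 / 2 + x : ℝ) : ℂ) :=
      (((analyticAt_zeta hu1).deriv).div (analyticAt_zeta hu1) hζ).differentiableAt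
    have := (hasDerivAt_re_comp_ofReal hdiff).comp x ((hasDerivAt_id x).const_add (1 / 2))
    simpa [Function.comp_def] using this
  have hGlim : Tendsto
      (fun σ : ℝ ↦ (deriv riemannZeta ((1 / 2 + σ : ℝ) : ℂ) / riemannZeta ((1 / 2 + σ : ℝ) : ℂ)).re)
      atTop (𝓝 0) := by
    have h1 := tendsto_logDeriv_zeta_atTop.comp (tendsto_atTop_add_const_left atTop (1 / 2 : ℝ) tendsto_id)
    simpa [Function.comp_def] using (Complex.continuous_re.tendsto 0).comp h1
  have hB1 : IntegrableOn
      (fun σ : ℝ ↦ (deriv (fun z : ℂ ↦ deriv riemannZeta z / riemannZeta z)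
        ((1 / 2 + σ : ℝ) : ℂ)).re) (Ioi (3 / 2)) := by
    refine integrableOn_Ioi_deriv_of_nonneg ?_
      (fun x hx ↦ hG x (by simp only [mem_Ioi] at hx; linarith)) (fun x hx ↦ ?_) hGlim
    · exact (hG (3 / 2) (by norm_num)).continuousAt.continuousWithinAt
    · have : (3 / 2 : ℝ) < x := hx
      have h := re_deriv_logDeriv_zeta_nonneg (u := 1 / 2 + x) (by linarith)
      exact h
  obtain ⟨hI1, -⟩ := integral_inv_sq_Ioi_one
  have hB2 : IntegrableOn (fun σ : ℝ ↦ 1 / (σ - 1 / 2) ^ 2) (Ioi (3 / 2)) :=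
    hI1.mono_set (Ioi_subset_Ioi (by norm_num))
  have hB : IntegrableOn
      (fun σ : ℝ ↦ (deriv (fun z : ℂ ↦ deriv riemannZeta₁ z / riemannZeta₁ z)
        ((1 / 2 + σ : ℝ) : ℂ)).re) (Ioi (3 / 2)) := by
    refine (hB1.sub hB2).congr_fun (fun σ hσ ↦ ?_) measurableSet_Ioi
    have hσ' : (3 / 2 : ℝ) < σ := hσ
    have hu1 : ((1 / 2 + σ : ℝ) : ℂ) ≠ 1 := by
      intro h; have := congrArg Complex.re h; simp at this; linarith
    have hζ : riemannZeta ((1 / 2 + σ : ℝ) : ℂ) ≠ 0 :=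
      riemannZeta_ne_zero_of_one_le_re (by simp; linarith)
    simp only [Pi.sub_apply]
    rw [deriv_logDeriv_zeta₁_eq hu1 hζ, Complex.sub_re]
    congr 1
    have e : ((1 / 2 + σ : ℝ) : ℂ) - 1 = ((σ - 1 / 2 : ℝ) : ℂ) := by push_cast; ring
    rw [e, ← Complex.ofReal_pow, ← Complex.ofReal_one, ← Complex.ofReal_div, Complex.ofReal_re]
  rw [← Ioc_union_Ioi_eq_Ioi (by norm_num : (1 / 2 : ℝ) ≤ 3 / 2)]
  exact hA.union hB

/-- **`∫_{σ>1/2} Re (ζ₁'/ζ₁)'(1/2+σ) dσ = −γ`** (`= lim_{u→∞} Re ζ₁'/ζ₁(u) − ζ₁'(1)/ζ₁(1) = 0 − γ`,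
Mathlib `deriv_riemannZeta₁_one`, `riemannZeta₁_one`). [folklore] -/
private theorem integral_reDerivLogDerivZeta₁ :
    ∫ σ in Ioi (1 / 2 : ℝ), (deriv (fun z : ℂ ↦ deriv riemannZeta₁ z / riemannZeta₁ z)
        ((1 / 2 + σ : ℝ) : ℂ)).re = -Real.eulerMascheroniConstant := by
  have hlim : Tendsto
      (fun σ : ℝ ↦ (deriv riemannZeta₁ ((1 / 2 + σ : ℝ) : ℂ) / riemannZeta₁ ((1 / 2 + σ : ℝ) : ℂ)).re)
      atTop (𝓝 0) := by
    have h1 := tendsto_re_logDeriv_zeta₁_atTop.comp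
      (tendsto_atTop_add_const_left atTop (1 / 2 : ℝ) tendsto_id)
    simpa [Function.comp_def] using h1
  rw [integral_Ioi_of_hasDerivAt_of_tendsto
    ((hasDerivAt_reLogDerivZeta₁_shift (by norm_num)).continuousAt.continuousWithinAt)
    (fun x hx ↦ hasDerivAt_reLogDerivZeta₁_shift (by simp only [mem_Ioi] at hx; linarith))
    integrableOn_reDerivLogDerivZeta₁ hlim]
  have e : ((1 / 2 + (1 / 2 : ℝ) : ℝ) : ℂ) = 1 := by norm_num
  rw [e, deriv_riemannZeta₁_one, riemannZeta₁_one, div_one, Complex.ofReal_re]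
  ring

/-! ### §9 The zero part integrates to `Σ_{Re ρ > 1/2} m(ρ)·Z(ρ)` with `Z(ρ) < 0`

For one zero `ρ = β + iγ` with `β > 1/2`, the second-derivative term at `a = 1/2` is supported on
`σ ∈ (1/2, β)` and has the primitive `−q(β−σ+1/2) + q(β−σ−1/2)`, `q(x) = x/(x²+γ²)`, whence
`∫_{1/2}^∞ [σ<β]·(q'(β−σ+½) − q'(β−σ−½)) dσ = q(β) − q(β−1) − 2q(½)
   = β/(β²+γ²) + (1−β)/((1−β)²+γ²) − 1/(1/4+γ²) = −(2β−1)²(β²−β+3γ²)/[(β²+γ²)((1−β)²+γ²)(4γ²+1)] < 0`. -/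

/-- **The integral of one zero's term** (`ρ ∈ 𝒵`):
`∫_{σ>1/2} [σ<β] m (q'(β−σ+½) − q'(β−σ−½)) dσ = m·[1/2<β]·(β/(β²+γ²) + (1−β)/((1−β)²+γ²) − 1/(¼+γ²))`,
with integrability. [folklore] -/
private theorem integral_zeroTerm_two (ρ : ZetaZeros.riemannZetaNontrivialZeros) :
    IntegrableOn (fun σ : ℝ ↦
        if σ < (ρ : ℂ).re then
          (riemannZetaZeroOrder (ρ : ℂ) : ℝ) *
            (((ρ : ℂ).im ^ 2 - ((ρ : ℂ).re - σ + 1 / 2) ^ 2) /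
                (((ρ : ℂ).re - σ + 1 / 2) ^ 2 + (ρ : ℂ).im ^ 2) ^ 2 -
              ((ρ : ℂ).im ^ 2 - ((ρ : ℂ).re - σ - 1 / 2) ^ 2) /
                (((ρ : ℂ).re - σ - 1 / 2) ^ 2 + (ρ : ℂ).im ^ 2) ^ 2)
        else 0) (Ioi (1 / 2)) ∧
      (∫ σ in Ioi (1 / 2 : ℝ),
        (if σ < (ρ : ℂ).re then
          (riemannZetaZeroOrder (ρ : ℂ) : ℝ) *
            (((ρ : ℂ).im ^ 2 - ((ρ : ℂ).re - σ + 1 / 2) ^ 2) /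
                (((ρ : ℂ).re - σ + 1 / 2) ^ 2 + (ρ : ℂ).im ^ 2) ^ 2 -
              ((ρ : ℂ).im ^ 2 - ((ρ : ℂ).re - σ - 1 / 2) ^ 2) /
                (((ρ : ℂ).re - σ - 1 / 2) ^ 2 + (ρ : ℂ).im ^ 2) ^ 2)
        else 0)) =
        (riemannZetaZeroOrder (ρ : ℂ) : ℝ) *
          (if 1 / 2 < (ρ : ℂ).re then
            (ρ : ℂ).re / ((ρ : ℂ).re ^ 2 + (ρ : ℂ).im ^ 2) +
              (1 - (ρ : ℂ).re) / ((1 - (ρ : ℂ).re) ^ 2 + (ρ : ℂ).im ^ 2) - 1 / (1 / 4 + (ρ : ℂ).im ^ 2)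
          else 0) := by
  set β : ℝ := (ρ : ℂ).re with hβ
  set γ : ℝ := (ρ : ℂ).im with hγdef
  set m : ℝ := (riemannZetaZeroOrder (ρ : ℂ) : ℝ) with hm
  have hγ : γ ≠ 0 := ZetaZeros.riemannZetaNontrivialZeros.im_ne_zero ρ.2
  have hβ1 : β < 1 := ZetaZeros.riemannZetaNontrivialZeros.re_lt_one ρ.2
  have hγ2 : 0 < γ ^ 2 := by positivity
  -- the smooth function and its primitive
  set g : ℝ → ℝ := fun σ ↦ m * ((γ ^ 2 - (β - σ + 1 / 2) ^ 2) / ((β - σ + 1 / 2) ^ 2 + γ ^ 2) ^ 2 -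
    (γ ^ 2 - (β - σ - 1 / 2) ^ 2) / ((β - σ - 1 / 2) ^ 2 + γ ^ 2) ^ 2) with hg
  set G : ℝ → ℝ := fun σ ↦ m * (-((β - σ + 1 / 2) / ((β - σ + 1 / 2) ^ 2 + γ ^ 2)) +
    (β - σ - 1 / 2) / ((β - σ - 1 / 2) ^ 2 + γ ^ 2)) with hG
  have hgcont : Continuous g := by
    refine continuous_const.mul (Continuous.sub ?_ ?_) <;>
      refine Continuous.div (by fun_prop) (by fun_prop) fun σ ↦ by positivity
  have hGderiv : ∀ x : ℝ, HasDerivAt G (g x) x := by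
    intro x
    have hA : (β - x + 1 / 2) ^ 2 + γ ^ 2 ≠ 0 := by positivity
    have hB : (β - x - 1 / 2) ^ 2 + γ ^ 2 ≠ 0 := by positivity
    have hq1 := hasDerivAt_poisson (a := β - x + 1 / 2) (t := γ) hA
    have hq2 := hasDerivAt_poisson (a := β - x - 1 / 2) (t := γ) hB
    have hl1 : HasDerivAt (fun x : ℝ ↦ β - x + 1 / 2) (-1) x := by
      simpa using ((hasDerivAt_id x).const_sub β).add_const (1 / 2)
    have hl2 : HasDerivAt (fun x : ℝ ↦ β - x - 1 / 2) (-1) x := by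
      simpa using ((hasDerivAt_id x).const_sub β).sub_const (1 / 2)
    have hc1 := (hq1.comp x hl1).neg
    have hc2 := hq2.comp x hl2
    have := (hc1.add hc2).const_mul m
    refine this.congr_deriv ?_
    simp only [hg, mul_neg_one, γ]
    ring
  -- the term equals `g` on `(1/2, β)` and `0` beyond `β`
  have hterm : ∀ σ : ℝ, (if σ < β then
      m * ((γ ^ 2 - (β - σ + 1 / 2) ^ 2) / ((β - σ + 1 / 2) ^ 2 + γ ^ 2) ^ 2 -
          (γ ^ 2 - (β - σ - 1 / 2) ^ 2) / ((β - σ - 1 / 2) ^ 2 + γ ^ 2) ^ 2)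
      else 0) = (Iio β).indicator g σ := by
    intro σ
    simp only [Set.indicator_apply, mem_Iio, hg]
  simp_rw [hterm]
  by_cases hβhalf : 1 / 2 < β
  · -- support `(1/2, β)`: an interval integral
    have hIoo : IntegrableOn g (Ioo (1 / 2) β) :=
      (hgcont.integrableOn_Icc (a := 1 / 2) (b := β)).mono_set Ioo_subset_Icc_self
    have hint : IntegrableOn ((Iio β).indicator g) (Ioi (1 / 2)) := by
      rw [IntegrableOn, integrable_indicator_iff measurableSet_Iio, IntegrableOn,
        Measure.restrict_restrict measurableSet_Iio, Iio_inter_Ioi]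
      exact hIoo
    refine ⟨hint, ?_⟩
    rw [setIntegral_indicator measurableSet_Iio, Ioi_inter_Iio,
      ← integral_Ioc_eq_integral_Ioo, ← intervalIntegral.integral_of_le hβhalf.le,
      intervalIntegral.integral_eq_sub_of_hasDerivAt (fun x _ ↦ hGderiv x)
        (hgcont.intervalIntegrable _ _), if_pos hβhalf]
    simp only [hG]
    field_simp
    ring
  · -- `β ≤ 1/2`: the term vanishes on `(1/2, ∞)`
    have hzero : ∀ σ ∈ Ioi (1 / 2 : ℝ), (Iio β).indicator g σ = 0 := by
      intro σ hσ
      have : ¬ σ < β := by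
        have h1 : (1 / 2 : ℝ) < σ := hσ
        linarith [not_lt.1 hβhalf]
      simp [this]
    refine ⟨(integrableOn_zero).congr_fun (fun σ hσ ↦ (hzero σ hσ).symm) measurableSet_Ioi, ?_⟩
    rw [setIntegral_congr_fun measurableSet_Ioi hzero, integral_zero, if_neg hβhalf, mul_zero]

/-- The closed form is NEGATIVE for an off-line zero: for `1/2 < β < 1`, `γ² ≥ 1`,
`β/(β²+γ²) + (1−β)/((1−β)²+γ²) − 1/(1/4+γ²) = −(2β−1)²(β²−β+3γ²)/[(β²+γ²)((1−β)²+γ²)(γ²+1/4)] < 0`.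
[folklore] -/
private theorem zval_neg {β γ : ℝ} (hβ : 1 / 2 < β) (hβ1 : β < 1) (hγ : 1 ≤ γ ^ 2) :
    β / (β ^ 2 + γ ^ 2) + (1 - β) / ((1 - β) ^ 2 + γ ^ 2) - 1 / (1 / 4 + γ ^ 2) < 0 := by
  have hA : 0 < β ^ 2 + γ ^ 2 := by positivity
  have hB : 0 < (1 - β) ^ 2 + γ ^ 2 := by positivity
  have hC : 0 < 1 / 4 + γ ^ 2 := by positivity
  have key : β / (β ^ 2 + γ ^ 2) + (1 - β) / ((1 - β) ^ 2 + γ ^ 2) - 1 / (1 / 4 + γ ^ 2) =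
      -((2 * β - 1) ^ 2 * (β ^ 2 - β + 3 * γ ^ 2)) /
        (4 * ((β ^ 2 + γ ^ 2) * ((1 - β) ^ 2 + γ ^ 2) * (1 / 4 + γ ^ 2))) := by
    field_simp
    ring
  rw [key, div_neg_iff]
  right
  refine ⟨?_, by positivity⟩
  rw [neg_lt_zero]
  have h1 : 0 < (2 * β - 1) ^ 2 := by
    have : 2 * β - 1 ≠ 0 := by linarith
    positivity
  have h2 : 0 < β ^ 2 - β + 3 * γ ^ 2 := by nlinarith
  positivity

/-- **Each zero's integrated contribution is `≤ 0`, and `< 0` exactly when `Re ρ > 1/2`.**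
[folklore] -/
private theorem zeroContribution_nonpos (ρ : ZetaZeros.riemannZetaNontrivialZeros) :
    (riemannZetaZeroOrder (ρ : ℂ) : ℝ) *
        (if 1 / 2 < (ρ : ℂ).re then
          (ρ : ℂ).re / ((ρ : ℂ).re ^ 2 + (ρ : ℂ).im ^ 2) +
            (1 - (ρ : ℂ).re) / ((1 - (ρ : ℂ).re) ^ 2 + (ρ : ℂ).im ^ 2) - 1 / (1 / 4 + (ρ : ℂ).im ^ 2)
        else 0) ≤ 0 := by
  by_cases h : 1 / 2 < (ρ : ℂ).re
  · rw [if_pos h]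
    have h14 : 14 < |(ρ : ℂ).im| := FordL33.fourteen_lt_abs_im ρ
    have hγ : 1 ≤ (ρ : ℂ).im ^ 2 := by
      have : (1 : ℝ) ≤ |(ρ : ℂ).im| := by linarith
      nlinarith [sq_abs (ρ : ℂ).im]
    have hz := zval_neg h (ZetaZeros.riemannZetaNontrivialZeros.re_lt_one ρ.2) hγ
    exact mul_nonpos_of_nonneg_of_nonpos (order_nonneg ρ) hz.le
  · rw [if_neg h, mul_zero]

/-- A zero with `Re ρ > 1/2` contributes a strictly negative amount. [folklore] -/
private theorem zeroContribution_neg (ρ : ZetaZeros.riemannZetaNontrivialZeros)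
    (h : 1 / 2 < (ρ : ℂ).re) :
    (riemannZetaZeroOrder (ρ : ℂ) : ℝ) *
        (if 1 / 2 < (ρ : ℂ).re then
          (ρ : ℂ).re / ((ρ : ℂ).re ^ 2 + (ρ : ℂ).im ^ 2) +
            (1 - (ρ : ℂ).re) / ((1 - (ρ : ℂ).re) ^ 2 + (ρ : ℂ).im ^ 2) - 1 / (1 / 4 + (ρ : ℂ).im ^ 2)
        else 0) < 0 := by
  rw [if_pos h]
  have h14 : 14 < |(ρ : ℂ).im| := FordL33.fourteen_lt_abs_im ρ
  have hγ : 1 ≤ (ρ : ℂ).im ^ 2 := by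
    have : (1 : ℝ) ≤ |(ρ : ℂ).im| := by linarith
    nlinarith [sq_abs (ρ : ℂ).im]
  have hz := zval_neg h (ZetaZeros.riemannZetaNontrivialZeros.re_lt_one ρ.2) hγ
  have hm : (0 : ℝ) < riemannZetaZeroOrder (ρ : ℂ) := by
    exact_mod_cast lt_of_lt_of_le zero_lt_one (ZetaZeros.riemannZetaNontrivialZeros.one_le_order ρ.2)
  exact mul_neg_of_pos_of_neg hm hz

/-- `L¹` size of one zero's term on `(1/2, ∞)`: at most `2 m(ρ)/(1+γ²)` (the term is bounded by
`4m/(1+γ²)` and supported in `(1/2, 1]`). [folklore] -/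
private theorem integral_norm_zeroTerm_two_le (ρ : ZetaZeros.riemannZetaNontrivialZeros) :
    ∫ σ in Ioi (1 / 2 : ℝ), ‖(if σ < (ρ : ℂ).re then
          (riemannZetaZeroOrder (ρ : ℂ) : ℝ) *
            (((ρ : ℂ).im ^ 2 - ((ρ : ℂ).re - σ + 1 / 2) ^ 2) /
                (((ρ : ℂ).re - σ + 1 / 2) ^ 2 + (ρ : ℂ).im ^ 2) ^ 2 -
              ((ρ : ℂ).im ^ 2 - ((ρ : ℂ).re - σ - 1 / 2) ^ 2) /
                (((ρ : ℂ).re - σ - 1 / 2) ^ 2 + (ρ : ℂ).im ^ 2) ^ 2)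
        else 0)‖ ≤
      2 * ((riemannZetaZeroOrder (ρ : ℂ) : ℝ) / (1 + (ρ : ℂ).im ^ 2)) := by
  set C : ℝ := 4 * ((riemannZetaZeroOrder (ρ : ℂ) : ℝ) / (1 + (ρ : ℂ).im ^ 2)) with hC
  have hC0 : 0 ≤ C := by
    have := order_nonneg ρ
    positivity
  have hβ1 : (ρ : ℂ).re < 1 := ZetaZeros.riemannZetaNontrivialZeros.re_lt_one ρ.2
  have hconst : IntegrableOn (fun σ : ℝ ↦ (Ioc (1 / 2 : ℝ) 1).indicator (fun _ ↦ C) σ) (Ioi (1 / 2)) :=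
    ((integrableOn_const (μ := volume) (s := Ioc (1 / 2 : ℝ) 1) (C := C)
      (by rw [Real.volume_Ioc]; exact ENNReal.ofReal_ne_top)).integrable_indicator
      measurableSet_Ioc).integrableOn
  have hle := setIntegral_mono_on (integral_zeroTerm_two ρ).1.norm hconst measurableSet_Ioi
    (fun σ hσ ↦ ?bound)
  case bound =>
    have hσ' : (1 / 2 : ℝ) < σ := hσ
    by_cases h1 : σ ≤ 1
    · rw [Set.indicator_of_mem (show σ ∈ Ioc (1 / 2 : ℝ) 1 from ⟨hσ', h1⟩)]
      by_cases hlt : σ < (ρ : ℂ).re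
      · rw [if_pos hlt, Real.norm_eq_abs]
        exact abs_zeroTerm_deriv_two_le ρ σ (1 / 2)
      · rw [if_neg hlt, norm_zero]; exact hC0
    · rw [if_neg (by linarith), norm_zero]
      exact Set.indicator_nonneg (s := Ioc (1 / 2 : ℝ) 1) (f := fun _ : ℝ ↦ C) (fun _ _ ↦ hC0) σ
  refine hle.trans ?_
  rw [setIntegral_indicator measurableSet_Ioc,
    show Ioi (1 / 2 : ℝ) ∩ Ioc (1 / 2) 1 = Ioc (1 / 2) 1 from
      Set.inter_eq_right.2 Ioc_subset_Ioi_self,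
    setIntegral_const, smul_eq_mul, Real.volume_real_Ioc_of_le (by norm_num), hC]
  apply le_of_eq
  ring

/-- **The zero part integrates term by term**:
`∫_{σ>1/2} Σ_ρ T₂(ρ,σ) dσ = Σ_ρ m(ρ)·[Re ρ>1/2]·Z(ρ)` as a convergent series (`Σ m(ρ)/(1+γ²) < ∞`).
[folklore] -/
private theorem hasSum_integral_zeroSum_two :
    HasSum (fun ρ : ZetaZeros.riemannZetaNontrivialZeros ↦
        (riemannZetaZeroOrder (ρ : ℂ) : ℝ) *
          (if 1 / 2 < (ρ : ℂ).re then
            (ρ : ℂ).re / ((ρ : ℂ).re ^ 2 + (ρ : ℂ).im ^ 2) +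
              (1 - (ρ : ℂ).re) / ((1 - (ρ : ℂ).re) ^ 2 + (ρ : ℂ).im ^ 2) - 1 / (1 / 4 + (ρ : ℂ).im ^ 2)
          else 0))
      (∫ σ in Ioi (1 / 2 : ℝ), ∑' ρ : ZetaZeros.riemannZetaNontrivialZeros,
        if σ < (ρ : ℂ).re then
          (riemannZetaZeroOrder (ρ : ℂ) : ℝ) *
            (((ρ : ℂ).im ^ 2 - ((ρ : ℂ).re - σ + 1 / 2) ^ 2) /
                (((ρ : ℂ).re - σ + 1 / 2) ^ 2 + (ρ : ℂ).im ^ 2) ^ 2 -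
              ((ρ : ℂ).im ^ 2 - ((ρ : ℂ).re - σ - 1 / 2) ^ 2) /
                (((ρ : ℂ).re - σ - 1 / 2) ^ 2 + (ρ : ℂ).im ^ 2) ^ 2)
        else 0) := by
  haveI : Countable ZetaZeros.riemannZetaNontrivialZeros :=
    riemannZetaNontrivialZeros_countable.to_subtype
  have hsum : Summable fun ρ : ZetaZeros.riemannZetaNontrivialZeros ↦
      ∫ σ in Ioi (1 / 2 : ℝ), ‖(if σ < (ρ : ℂ).re then
          (riemannZetaZeroOrder (ρ : ℂ) : ℝ) *
            (((ρ : ℂ).im ^ 2 - ((ρ : ℂ).re - σ + 1 / 2) ^ 2) /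
                (((ρ : ℂ).re - σ + 1 / 2) ^ 2 + (ρ : ℂ).im ^ 2) ^ 2 -
              ((ρ : ℂ).im ^ 2 - ((ρ : ℂ).re - σ - 1 / 2) ^ 2) /
                (((ρ : ℂ).re - σ - 1 / 2) ^ 2 + (ρ : ℂ).im ^ 2) ^ 2)
        else 0)‖ :=
    Summable.of_nonneg_of_le (fun ρ ↦ integral_nonneg fun σ ↦ norm_nonneg _)
      integral_norm_zeroTerm_two_le (summable_order_div_one_add_im_sq.mul_left 2)
  have h := hasSum_integral_of_summable_integral_norm (μ := volume.restrict (Ioi (1 / 2 : ℝ)))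
    (fun ρ ↦ (integral_zeroTerm_two ρ).1) hsum
  have e : (fun ρ : ZetaZeros.riemannZetaNontrivialZeros ↦
        (riemannZetaZeroOrder (ρ : ℂ) : ℝ) *
          (if 1 / 2 < (ρ : ℂ).re then
            (ρ : ℂ).re / ((ρ : ℂ).re ^ 2 + (ρ : ℂ).im ^ 2) +
              (1 - (ρ : ℂ).re) / ((1 - (ρ : ℂ).re) ^ 2 + (ρ : ℂ).im ^ 2) - 1 / (1 / 4 + (ρ : ℂ).im ^ 2)
          else 0)) = fun ρ : ZetaZeros.riemannZetaNontrivialZeros ↦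
        ∫ σ in Ioi (1 / 2 : ℝ), (if σ < (ρ : ℂ).re then
          (riemannZetaZeroOrder (ρ : ℂ) : ℝ) *
            (((ρ : ℂ).im ^ 2 - ((ρ : ℂ).re - σ + 1 / 2) ^ 2) /
                (((ρ : ℂ).re - σ + 1 / 2) ^ 2 + (ρ : ℂ).im ^ 2) ^ 2 -
              ((ρ : ℂ).im ^ 2 - ((ρ : ℂ).re - σ - 1 / 2) ^ 2) /
                (((ρ : ℂ).re - σ - 1 / 2) ^ 2 + (ρ : ℂ).im ^ 2) ^ 2)
        else 0) := funext fun ρ ↦ ((integral_zeroTerm_two ρ).2).symm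
  rw [e]
  exact h

/-! ### §10 Joint integrability of `(1−12t²)/(1+4t²)³·log|ζ(σ+it)|` on `(0,∞) × (1/2,∞)`

Tonelli with `σ` outer. For `σ ∈ (1/2, 3]`, `σ ≠ 1`: `|log|ζ|| = 2 log⁺|ζ| − log|ζ|`, the Poisson
mean of `log|ζ(σ+it)|` at `a = 1/2` is `π(e(σ,½) + Σ_ρ T) ≥ π e(σ,½) ≥ −π K` (zero terms `≥ 0`,
`ζ₁` bounded below on `[1, 7/2]`), and `log⁺|ζ(σ+it)| ≤ 3 log(|t|+5) + log 5 + (−log|t|)⁺`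
(polynomial growth; the pole); for `σ > 3`, `|log|ζ(σ+it)|| ≤ 4e^{−σ log 2}`. -/

/-- Pointwise majorant of `log⁺|ζ(σ+it)|` for `1/2 ≤ σ ≤ 3`, `t ≠ 0`:
`max(log|ζ(σ+it)|, 0) ≤ 3 log(|t|+5) + log 5 + max(−log|t|, 0)`. [folklore] -/
private theorem posLog_logZeta_le {σ t : ℝ} (hσ : σ ∈ Icc (1 / 2 : ℝ) 3) (ht : t ≠ 0) :
    max (Real.log ‖riemannZeta (σ + t * I)‖) 0 ≤
      3 * Real.log (|t| + 5) + Real.log 5 + max (-Real.log |t|) 0 := by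
  set s : ℂ := (σ : ℂ) + t * I with hs
  have hsre : s.re = σ := by simp [hs]
  have hsim : s.im = t := by simp [hs]
  have hs1 : s ≠ 1 := by
    intro h; have := congrArg Complex.im h; rw [hsim] at this; simp at this; exact ht this
  have hlog5 : 0 ≤ Real.log 5 := Real.log_nonneg (by norm_num)
  have hlogt : 0 ≤ Real.log (|t| + 5) := Real.log_nonneg (by linarith [abs_nonneg t])
  have hmax : 0 ≤ max (-Real.log |t|) 0 := le_max_right _ _
  have hns : ‖s‖ ≤ |σ| + |t| := by
    calc ‖s‖ ≤ ‖(σ : ℂ)‖ + ‖(t : ℂ) * I‖ := norm_add_le _ _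
      _ = |σ| + |t| := by simp
  have hσabs : |σ| ≤ 3 := by rw [abs_le]; constructor <;> linarith [hσ.1, hσ.2]
  have hs1norm : |t| ≤ ‖s - 1‖ := by
    have : (s - 1).im = t := by simp [hsim]
    rw [← this]; exact Complex.abs_im_le_norm _
  -- `log|ζ s| ≤ B` with `B ≥ 0` gives `max(log|ζ s|, 0) ≤ B`
  suffices hmain : Real.log ‖riemannZeta s‖ ≤ 3 * Real.log (|t| + 5) + Real.log 5 + max (-Real.log |t|) 0 by
    exact max_le hmain (by positivity)
  by_cases hζ0 : ‖riemannZeta s‖ = 0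
  · rw [hζ0, Real.log_zero]; positivity
  have hζpos : 0 < ‖riemannZeta s‖ := lt_of_le_of_ne (norm_nonneg _) (Ne.symm hζ0)
  by_cases h1 : 1 ≤ |t|
  · -- polynomial growth away from the pole
    have hb := norm_riemannZeta_le_cube (w := s) (by rw [hsre]; linarith [hσ.1]) (h1.trans hs1norm)
    have hb' : ‖riemannZeta s‖ ≤ (|t| + 5) ^ 3 :=
      hb.trans (pow_le_pow_left₀ (by positivity) (by linarith) 3)
    calc Real.log ‖riemannZeta s‖ ≤ Real.log ((|t| + 5) ^ 3) := Real.log_le_log hζpos hb'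
      _ = 3 * Real.log (|t| + 5) := by rw [Real.log_pow]; norm_num
      _ ≤ _ := by linarith
  · -- near the pole: `|ζ(s)| ≤ 1/|t| + 4 ≤ 5/|t|`
    rw [not_le] at h1
    have htpos : 0 < |t| := abs_pos.2 ht
    have hb := norm_riemannZeta_le_of_neg_one_le_re (s := s) (by rw [hsre]; linarith [hσ.1]) hs1
    have hn4 : ‖s‖ ≤ 4 := by linarith
    have hn5 : ‖s + 1‖ ≤ 5 := by
      calc ‖s + 1‖ ≤ ‖s‖ + ‖(1 : ℂ)‖ := norm_add_le _ _
        _ ≤ 5 := by rw [norm_one]; linarith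
    have hn6 : ‖s + 2‖ ≤ 6 := by
      calc ‖s + 2‖ ≤ ‖s‖ + ‖(2 : ℂ)‖ := norm_add_le _ _
        _ ≤ 6 := by rw [Complex.norm_two]; linarith
    have hinv : 1 / ‖s - 1‖ ≤ 1 / |t| := div_le_div_of_nonneg_left zero_le_one htpos hs1norm
    have hprod : ‖s‖ * ‖s + 1‖ * ‖s + 2‖ ≤ 4 * 5 * 6 := by
      have := mul_le_mul (mul_le_mul hn4 hn5 (norm_nonneg _) (by norm_num)) hn6 (norm_nonneg _)
        (by norm_num)
      simpa using this
    have hb' : ‖riemannZeta s‖ ≤ 5 / |t| := by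
      have h4 : 1 / 2 + ‖s‖ / 12 + ‖s‖ * ‖s + 1‖ * ‖s + 2‖ / 48 ≤ 4 := by linarith
      have h5 : (4 : ℝ) ≤ 4 / |t| := by
        rw [le_div_iff₀ htpos]; nlinarith
      calc ‖riemannZeta s‖ ≤ 1 / ‖s - 1‖ + (1 / 2 + ‖s‖ / 12 + ‖s‖ * ‖s + 1‖ * ‖s + 2‖ / 48) := by
            linarith
        _ ≤ 1 / |t| + 4 / |t| := add_le_add hinv (h4.trans h5)
        _ = 5 / |t| := by ring
    calc Real.log ‖riemannZeta s‖ ≤ Real.log (5 / |t|) := Real.log_le_log hζpos hb'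
      _ = Real.log 5 + -Real.log |t| := by rw [Real.log_div (by norm_num) htpos.ne']; ring
      _ ≤ Real.log 5 + max (-Real.log |t|) 0 := by gcongr; exact le_max_left _ _
      _ ≤ _ := by linarith

/-- `√|t|·(1/2)/(1/4+t²)` is integrable on `ℝ` (it is `≤ 8(1+|t|)^{−3/2}`). [folklore] -/
private theorem integrable_sqrt_mul_poisson :
    Integrable fun t : ℝ ↦ Real.sqrt |t| * ((1 / 2) / ((1 / 2) ^ 2 + t ^ 2)) := by
  have h := (integrable_one_add_norm (E := ℝ) (μ := volume) (r := 3 / 2)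
    (by simp; norm_num)).const_mul 8
  refine h.mono' (by fun_prop) (ae_of_all _ fun t ↦ ?_)
  have ht0 : 0 ≤ |t| := abs_nonneg t
  have h1 : 0 < 1 + |t| := by positivity
  rw [Real.norm_eq_abs, abs_of_nonneg (by positivity), Real.norm_eq_abs]
  rw [Real.rpow_neg h1.le, show (3 / 2 : ℝ) = 1 + 1 / 2 by norm_num, Real.rpow_add h1,
    Real.rpow_one, ← Real.sqrt_eq_rpow]
  have hsq : Real.sqrt |t| ≤ Real.sqrt (1 + |t|) := Real.sqrt_le_sqrt (by linarith)
  have hs1 : 0 < Real.sqrt (1 + |t|) := Real.sqrt_pos.2 h1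
  rw [← div_eq_mul_inv, le_div_iff₀ (by positivity)]
  have hq : (0 : ℝ) < (1 / 2) ^ 2 + t ^ 2 := by positivity
  rw [show Real.sqrt |t| * ((1 / 2) / ((1 / 2) ^ 2 + t ^ 2)) * ((1 + |t|) * Real.sqrt (1 + |t|)) =
    (Real.sqrt |t| * Real.sqrt (1 + |t|)) * ((1 + |t|) / 2) / ((1 / 2) ^ 2 + t ^ 2) by
      field_simp]
  rw [div_le_iff₀ hq]
  have h3 : Real.sqrt |t| * Real.sqrt (1 + |t|) ≤ 1 + |t| := by
    calc Real.sqrt |t| * Real.sqrt (1 + |t|) ≤ Real.sqrt (1 + |t|) * Real.sqrt (1 + |t|) :=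
          mul_le_mul_of_nonneg_right hsq hs1.le
      _ = 1 + |t| := Real.mul_self_sqrt h1.le
  have h4 : (1 + |t|) * ((1 + |t|) / 2) ≤ 8 * ((1 / 2) ^ 2 + t ^ 2) := by
    nlinarith [sq_abs t, sq_nonneg (|t| - 1)]
  calc Real.sqrt |t| * Real.sqrt (1 + |t|) * ((1 + |t|) / 2)
      ≤ (1 + |t|) * ((1 + |t|) / 2) := mul_le_mul_of_nonneg_right h3 (by positivity)
    _ ≤ 8 * ((1 / 2) ^ 2 + t ^ 2) := h4

/-- `log(|t|+5) ≤ log 5 + 2√|t|`. [folklore] -/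
private theorem log_abs_add_five_le (t : ℝ) : Real.log (|t| + 5) ≤ Real.log 5 + 2 * Real.sqrt |t| := by
  have ht0 : 0 ≤ |t| := abs_nonneg t
  have h1 : Real.log (|t| + 5) = Real.log 5 + Real.log (1 + |t| / 5) := by
    rw [← Real.log_mul (by norm_num) (by positivity)]; congr 1; ring
  rw [h1]
  gcongr
  -- `log(1+x) ≤ 2(√(1+x) − 1) ≤ 2√x`
  have h2 : 0 < 1 + |t| / 5 := by positivity
  have h3 : Real.log (1 + |t| / 5) = 2 * Real.log (Real.sqrt (1 + |t| / 5)) := by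
    rw [Real.log_sqrt h2.le]; ring
  rw [h3]
  have h4 := Real.log_le_sub_one_of_pos (Real.sqrt_pos.2 h2)
  have h5 : Real.sqrt (1 + |t| / 5) ≤ 1 + Real.sqrt |t| := by
    rw [Real.sqrt_le_left (by positivity)]
    nlinarith [Real.sq_sqrt ht0, Real.sqrt_nonneg |t|]
  linarith

/-- The Poisson kernel at `a = 1/2` is integrable on `ℝ`. [folklore] -/
private theorem integrable_poisson_half :
    Integrable fun t : ℝ ↦ (1 / 2 : ℝ) / ((1 / 2) ^ 2 + t ^ 2) := by
  have h := (integrable_inv_one_add_sq.comp_mul_left' (R := 2) (by norm_num)).const_mul 2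
  refine h.congr (ae_of_all _ fun t ↦ ?_)
  simp only
  have : (0 : ℝ) < 1 + (2 * t) ^ 2 := by positivity
  have : (0 : ℝ) < (1 / 2) ^ 2 + t ^ 2 := by positivity
  field_simp

/-- The majorant `(1/2)/(1/4+t²)·(3 log(|t|+5) + log 5 + max(−log|t|,0))` is integrable on `ℝ`.
[folklore] -/
private theorem integrable_poisson_majorant :
    Integrable fun t : ℝ ↦ (1 / 2 : ℝ) / ((1 / 2) ^ 2 + t ^ 2) *
      (3 * Real.log (|t| + 5) + Real.log 5 + max (-Real.log |t|) 0) := by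
  -- dominate by `P·(4 log 5) + 6 √|t| P + 2 max(−log|t|,0)`
  have hP := integrable_poisson_half
  have h1 : Integrable fun t : ℝ ↦ (4 * Real.log 5) * ((1 / 2 : ℝ) / ((1 / 2) ^ 2 + t ^ 2)) +
      6 * (Real.sqrt |t| * ((1 / 2) / ((1 / 2) ^ 2 + t ^ 2))) + 2 * max (-Real.log |t|) 0 :=
    ((hP.const_mul _).add (integrable_sqrt_mul_poisson.const_mul 6)).add
      (ZetaLogNormVertical.integrable_posPart_neg_log_abs.const_mul 2)
  refine h1.mono' (by
    refine ((by fun_prop : Measurable fun t : ℝ ↦ (1 / 2 : ℝ) / ((1 / 2) ^ 2 + t ^ 2)).mul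
      ?_).aestronglyMeasurable
    refine ((Measurable.const_mul ?_ 3).add measurable_const).add ?_
    · exact Real.measurable_log.comp (by fun_prop)
    · exact (Real.measurable_log.comp (by fun_prop)).neg.max measurable_const)
    (ae_of_all _ fun t ↦ ?_)
  have hPpos : 0 < (1 / 2 : ℝ) / ((1 / 2) ^ 2 + t ^ 2) := by positivity
  have hP2 : (1 / 2 : ℝ) / ((1 / 2) ^ 2 + t ^ 2) ≤ 2 := by
    rw [div_le_iff₀ (by positivity)]; nlinarith [sq_nonneg t]
  have hlog5 : 0 ≤ Real.log 5 := Real.log_nonneg (by norm_num)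
  have hlogt : 0 ≤ Real.log (|t| + 5) := Real.log_nonneg (by linarith [abs_nonneg t])
  have hmax : 0 ≤ max (-Real.log |t|) 0 := le_max_right _ _
  have hB : 0 ≤ 3 * Real.log (|t| + 5) + Real.log 5 + max (-Real.log |t|) 0 := by positivity
  rw [Real.norm_eq_abs, abs_of_nonneg (mul_nonneg hPpos.le hB)]
  have hl := log_abs_add_five_le t
  set P := (1 / 2 : ℝ) / ((1 / 2) ^ 2 + t ^ 2) with hPdef
  calc P * (3 * Real.log (|t| + 5) + Real.log 5 + max (-Real.log |t|) 0)
      ≤ P * (3 * (Real.log 5 + 2 * Real.sqrt |t|) + Real.log 5 + max (-Real.log |t|) 0) := by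
        gcongr
    _ = 4 * Real.log 5 * P + 6 * (Real.sqrt |t| * P) + P * max (-Real.log |t|) 0 := by ring
    _ ≤ 4 * Real.log 5 * P + 6 * (Real.sqrt |t| * P) + 2 * max (-Real.log |t|) 0 := by
        gcongr

/-- `ζ₁` is bounded below by a positive constant on the real segment `[1, 7/2]` (continuity,
compactness, `ζ₁(u) ≠ 0` for `u > 0`). [folklore] -/
private theorem exists_zeta₁_lower :
    ∃ c : ℝ, 0 < c ∧ ∀ u ∈ Icc (1 : ℝ) (7 / 2), c ≤ ‖riemannZeta₁ (u : ℂ)‖ := by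
  have hcont : ContinuousOn (fun u : ℝ ↦ ‖riemannZeta₁ (u : ℂ)‖) (Icc (1 : ℝ) (7 / 2)) :=
    ((differentiable_riemannZeta₁.continuous.comp continuous_ofReal).norm).continuousOn
  obtain ⟨u₀, hu₀, hmin⟩ := isCompact_Icc.exists_isMinOn (nonempty_Icc.2 (by norm_num)) hcont
  refine ⟨‖riemannZeta₁ (u₀ : ℂ)‖, norm_pos_iff.2 (riemannZeta₁_ofReal_ne_zero' (by linarith [hu₀.1])),
    fun u hu ↦ hmin hu⟩

/-- The zero terms at any `a > 0` are non-negative: `‖ρ−σ−a‖ ≤ ‖ρ−σ+a‖` when `σ < Re ρ`.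
[folklore] -/
private theorem zeroTerm_nonneg (ρ : ZetaZeros.riemannZetaNontrivialZeros) (σ : ℝ) {a : ℝ} (ha : 0 < a) :
    0 ≤ (if σ < (ρ : ℂ).re then
        (riemannZetaZeroOrder (ρ : ℂ) : ℝ) * Real.log (‖(ρ : ℂ) - σ + a‖ / ‖(ρ : ℂ) - σ - a‖)
      else 0) := by
  by_cases hlt : σ < (ρ : ℂ).re
  · rw [if_pos hlt]
    refine mul_nonneg (order_nonneg ρ) (Real.log_nonneg ?_)
    have hγ : (ρ : ℂ).im ≠ 0 := ZetaZeros.riemannZetaNontrivialZeros.im_ne_zero ρ.2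
    have hpos : 0 < ‖(ρ : ℂ) - σ - a‖ := by
      rw [norm_pos_iff]; intro h
      have := congrArg Complex.im h; simp at this; exact hγ this
    rw [le_div_iff₀ hpos, one_mul]
    rw [Complex.norm_eq_sqrt_sq_add_sq, Complex.norm_eq_sqrt_sq_add_sq]
    refine Real.sqrt_le_sqrt ?_
    simp only [sub_re, ofReal_re, add_re, sub_im, ofReal_im, add_im, sub_zero, add_zero]
    nlinarith
  · rw [if_neg hlt]

/-- **Uniform `L¹` bound for the Poisson means near the strip**: there is `K₀` with
`∫_ℝ |log|ζ(σ+it)||·(1/2)/(1/4+t²) dt ≤ K₀` for all `σ ∈ [1/2, 3]`, `σ ≠ 1`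
(`|log|ζ|| = 2 log⁺|ζ| − log|ζ|`; the Poisson mean of `log|ζ|` is `≥ π·e(σ,1/2)`, the zero sum being
`≥ 0`; `log⁺|ζ|` under the majorant of `posLog_logZeta_le`). [folklore] -/
private theorem exists_poisson_abs_le :
    ∃ K₀ : ℝ, ∀ σ ∈ Icc (1 / 2 : ℝ) 3, σ ≠ 1 →
      ∫ t : ℝ, |Real.log ‖riemannZeta (σ + t * I)‖| * ((1 / 2 : ℝ) / ((1 / 2) ^ 2 + t ^ 2)) ≤ K₀ := by
  obtain ⟨c, hc0, hc⟩ := exists_zeta₁_lower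
  set IB : ℝ := ∫ t : ℝ, (1 / 2 : ℝ) / ((1 / 2) ^ 2 + t ^ 2) *
    (3 * Real.log (|t| + 5) + Real.log 5 + max (-Real.log |t|) 0) with hIB
  refine ⟨2 * IB + π * (Real.log 3 - Real.log c), fun σ hσ hσ1 ↦ ?_⟩
  have hσ' : 1 / 2 ≤ σ := hσ.1
  -- the Poisson mean at `a = 1/2`
  have hmean := poissonMean_eq hσ' hσ1 (a := 1 / 2) (by norm_num)
  have hmeas_w : Measurable fun t : ℝ ↦ (1 / 2 : ℝ) / ((1 / 2) ^ 2 + t ^ 2) := by fun_prop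
  have hwb : ∀ t : ℝ, |(1 / 2 : ℝ) / ((1 / 2) ^ 2 + t ^ 2)| ≤ 1 / (1 / 16 + t ^ 2) := fun t ↦ by
    have h1 : (0 : ℝ) < (1 / 2) ^ 2 + t ^ 2 := by positivity
    have h2 : (0 : ℝ) < 1 / 16 + t ^ 2 := by positivity
    rw [abs_of_pos (by positivity), div_le_div_iff₀ h1 h2]
    nlinarith [sq_nonneg t]
  have hIΛ : Integrable fun t : ℝ ↦
      Real.log ‖riemannZeta (σ + t * I)‖ * ((1 / 2 : ℝ) / ((1 / 2) ^ 2 + t ^ 2)) :=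
    integrable_logZeta_mul hσ' hσ1 hmeas_w (C := 1) hwb
  -- lower bound for the mean: zero sum `≥ 0`, elementary part `≥ log c − log 3`
  have hZ : 0 ≤ ∑' ρ : ZetaZeros.riemannZetaNontrivialZeros,
      (if σ < (ρ : ℂ).re then
        (riemannZetaZeroOrder (ρ : ℂ) : ℝ) *
          Real.log (‖(ρ : ℂ) - σ + (1 / 2 : ℝ)‖ / ‖(ρ : ℂ) - σ - (1 / 2 : ℝ)‖)
      else 0) := tsum_nonneg fun ρ ↦ zeroTerm_nonneg ρ σ (by norm_num)
  have he : Real.log c - Real.log 3 ≤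
      Real.log ‖riemannZeta₁ ((1 / 2 + σ : ℝ) : ℂ)‖ - Real.log (1 / 2 + |1 - σ|) := by
    have h1 : Real.log c ≤ Real.log ‖riemannZeta₁ ((1 / 2 + σ : ℝ) : ℂ)‖ :=
      Real.log_le_log hc0 (hc _ ⟨by linarith, by linarith [hσ.2]⟩)
    have h2 : Real.log (1 / 2 + |1 - σ|) ≤ Real.log 3 := by
      refine Real.log_le_log (by positivity) ?_
      have : |1 - σ| ≤ 5 / 2 := by rw [abs_le]; constructor <;> linarith [hσ.2]
      linarith
    linarith
  have hlow : π * (Real.log c - Real.log 3) ≤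
      ∫ t : ℝ, Real.log ‖riemannZeta (σ + t * I)‖ * ((1 / 2 : ℝ) / ((1 / 2) ^ 2 + t ^ 2)) := by
    rw [hmean]
    exact mul_le_mul_of_nonneg_left (by linarith) Real.pi_pos.le
  -- the `log⁺` part under the majorant
  have hpos_int : Integrable fun t : ℝ ↦
      max (Real.log ‖riemannZeta (σ + t * I)‖) 0 * ((1 / 2 : ℝ) / ((1 / 2) ^ 2 + t ^ 2)) := by
    refine integrable_poisson_majorant.mono' (((measurable_logZeta σ).max measurable_const).mul
      hmeas_w).aestronglyMeasurable ?_
    have h0 : ∀ᵐ t : ℝ, t ≠ 0 := by rw [ae_iff]; simp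
    filter_upwards [h0] with t ht
    have hP : 0 ≤ (1 / 2 : ℝ) / ((1 / 2) ^ 2 + t ^ 2) := by positivity
    rw [Real.norm_eq_abs, abs_of_nonneg (mul_nonneg (le_max_right _ _) hP), mul_comm]
    exact mul_le_mul_of_nonneg_left (posLog_logZeta_le hσ ht) hP
  have hpos_le : ∫ t : ℝ, max (Real.log ‖riemannZeta (σ + t * I)‖) 0 *
      ((1 / 2 : ℝ) / ((1 / 2) ^ 2 + t ^ 2)) ≤ IB := by
    refine integral_mono_ae hpos_int integrable_poisson_majorant ?_
    have h0 : ∀ᵐ t : ℝ, t ≠ 0 := by rw [ae_iff]; simp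
    filter_upwards [h0] with t ht
    have hP : 0 ≤ (1 / 2 : ℝ) / ((1 / 2) ^ 2 + t ^ 2) := by positivity
    rw [mul_comm]
    exact mul_le_mul_of_nonneg_left (posLog_logZeta_le hσ ht) hP
  -- `|Λ| = 2 max(Λ,0) − Λ`
  have hid : ∀ t : ℝ, |Real.log ‖riemannZeta (σ + t * I)‖| * ((1 / 2 : ℝ) / ((1 / 2) ^ 2 + t ^ 2)) =
      2 * (max (Real.log ‖riemannZeta (σ + t * I)‖) 0 * ((1 / 2 : ℝ) / ((1 / 2) ^ 2 + t ^ 2))) -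
        Real.log ‖riemannZeta (σ + t * I)‖ * ((1 / 2 : ℝ) / ((1 / 2) ^ 2 + t ^ 2)) := by
    intro t
    rcases le_or_gt 0 (Real.log ‖riemannZeta (σ + t * I)‖) with h | h
    · rw [abs_of_nonneg h, max_eq_left h]; ring
    · rw [abs_of_neg h, max_eq_right h.le]; ring
  simp_rw [hid]
  rw [integral_sub (hpos_int.const_mul 2) hIΛ, integral_const_mul]
  linarith

/-- Far to the right: `∫_ℝ |log|ζ(σ+it)||·(1/2)/(1/4+t²) dt ≤ 4e^{−σ log 2}·∫(1/2)/(1/4+t²)` for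
`σ ≥ 3`. [folklore] -/
private theorem poisson_abs_le_of_three_le {σ : ℝ} (hσ : 3 ≤ σ) :
    ∫ t : ℝ, |Real.log ‖riemannZeta (σ + t * I)‖| * ((1 / 2 : ℝ) / ((1 / 2) ^ 2 + t ^ 2)) ≤
      4 * Real.exp (-Real.log 2 * σ) * ∫ t : ℝ, (1 / 2 : ℝ) / ((1 / 2) ^ 2 + t ^ 2) := by
  rw [← integral_const_mul]
  refine integral_mono_of_nonneg (ae_of_all _ fun t ↦ by positivity)
    (integrable_poisson_half.const_mul _) (ae_of_all _ fun t ↦ ?_)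
  have hP : 0 ≤ (1 / 2 : ℝ) / ((1 / 2) ^ 2 + t ^ 2) := by positivity
  exact mul_le_mul_of_nonneg_right (abs_log_norm_riemannZeta_le_of_three_le hσ t) hP

/-- **Joint integrability**: `(t, σ) ↦ (1−12t²)/(1+4t²)³·log|ζ(σ+it)|` is integrable on
`(0,∞) × (1/2,∞)` (Tonelli with `σ` outer: uniform Poisson-mean bound on `(1/2,3]`, exponential
decay beyond). [folklore] -/
private theorem integrable_weight_logZeta_prod :
    Integrable (fun p : ℝ × ℝ ↦ (1 - 12 * p.1 ^ 2) / (1 + 4 * p.1 ^ 2) ^ 3 *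
        Real.log ‖riemannZeta (p.2 + p.1 * I)‖)
      ((volume.restrict (Ioi (0 : ℝ))).prod (volume.restrict (Ioi (1 / 2 : ℝ)))) := by
  set μ : Measure ℝ := volume.restrict (Ioi (0 : ℝ)) with hμ
  set ν : Measure ℝ := volume.restrict (Ioi (1 / 2 : ℝ)) with hν
  obtain ⟨K₀, hK₀⟩ := exists_poisson_abs_le
  set IP : ℝ := ∫ t : ℝ, (1 / 2 : ℝ) / ((1 / 2) ^ 2 + t ^ 2) with hIP
  have hmeas : Measurable fun p : ℝ × ℝ ↦ (1 - 12 * p.1 ^ 2) / (1 + 4 * p.1 ^ 2) ^ 3 *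
      Real.log ‖riemannZeta (p.2 + p.1 * I)‖ := by
    refine Measurable.mul (by fun_prop) ?_
    exact measurable_logZeta_uncurry.comp measurable_swap
  have h1f : AEStronglyMeasurable (fun p : ℝ × ℝ ↦ (1 - 12 * p.1 ^ 2) / (1 + 4 * p.1 ^ 2) ^ 3 *
      Real.log ‖riemannZeta (p.2 + p.1 * I)‖) (μ.prod ν) := hmeas.aestronglyMeasurable
  rw [integrable_prod_iff' h1f]
  have hae1 : ∀ᵐ σ : ℝ ∂ν, σ ≠ 1 := by
    refine ae_restrict_of_ae ?_
    rw [ae_iff]; simp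
  have haeI : ∀ᵐ σ : ℝ ∂ν, σ ∈ Ioi (1 / 2 : ℝ) := ae_restrict_mem measurableSet_Ioi
  have hwb : ∀ t : ℝ, |(1 - 12 * t ^ 2) / (1 + 4 * t ^ 2) ^ 3| ≤ (3 / 4) / (1 / 16 + t ^ 2) := by
    intro t
    refine (abs_weight_le t).trans ?_
    have h1 : (0 : ℝ) < (1 / 2) ^ 2 + t ^ 2 := by positivity
    have h2 : (0 : ℝ) < 1 / 16 + t ^ 2 := by positivity
    rw [← mul_div_assoc, div_le_div_iff₀ h1 h2]
    nlinarith [sq_nonneg t]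
  -- (a) each line `σ > 1/2`, `σ ≠ 1`
  have hline : ∀ σ : ℝ, 1 / 2 < σ → σ ≠ 1 → Integrable (fun t : ℝ ↦
      (1 - 12 * t ^ 2) / (1 + 4 * t ^ 2) ^ 3 * Real.log ‖riemannZeta (σ + t * I)‖) := by
    intro σ hσ hσ1
    have h := integrable_logZeta_mul hσ.le hσ1 (g := fun t : ℝ ↦ (1 - 12 * t ^ 2) / (1 + 4 * t ^ 2) ^ 3)
      (by fun_prop) (C := 3 / 4) hwb
    exact h.congr (ae_of_all _ fun t ↦ by ring)
  constructor
  · filter_upwards [hae1, haeI] with σ hσ1 hσ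
    exact (hline σ hσ hσ1).restrict
  -- (b) the `σ`-integrability of the `t`-integrals of the absolute value
  have hmeasM : AEStronglyMeasurable (fun σ : ℝ ↦ ∫ t : ℝ, ‖(1 - 12 * t ^ 2) / (1 + 4 * t ^ 2) ^ 3 *
      Real.log ‖riemannZeta (σ + t * I)‖‖ ∂μ) ν := by
    have := (h1f.prod_swap).norm.integral_prod_right'
    simpa using this
  -- the dominating function of `σ`
  set B : ℝ → ℝ := fun σ ↦ 3 / 2 * (K₀ * (Iic (3 : ℝ)).indicator (fun _ ↦ (1 : ℝ)) σ +
    4 * Real.exp (-Real.log 2 * σ) * IP) with hB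
  have hBint : Integrable B ν := by
    have h1 : Integrable (fun σ : ℝ ↦ (Iic (3 : ℝ)).indicator (fun _ ↦ (1 : ℝ)) σ) ν := by
      rw [hν, ← IntegrableOn, IntegrableOn, integrable_indicator_iff measurableSet_Iic, IntegrableOn,
        Measure.restrict_restrict measurableSet_Iic]
      refine integrableOn_const ?_
      rw [show Iic (3 : ℝ) ∩ Ioi (1 / 2) = Ioc (1 / 2) 3 by ext x; simp [and_comm], Real.volume_Ioc]
      exact ENNReal.ofReal_ne_top
    have h2 : Integrable (fun σ : ℝ ↦ Real.exp (-Real.log 2 * σ)) ν :=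
      exp_neg_integrableOn_Ioi (1 / 2) (Real.log_pos (by norm_num))
    have := ((h1.const_mul K₀).add ((h2.const_mul 4).mul_const IP)).const_mul (3 / 2)
    refine this.congr (ae_of_all _ fun σ ↦ ?_)
    simp only [hB, Pi.add_apply]
  refine Integrable.mono' hBint hmeasM ?_
  filter_upwards [hae1, haeI] with σ hσ1 hσ
  have hσ' : (1 / 2 : ℝ) < σ := hσ
  rw [Real.norm_eq_abs, abs_of_nonneg (integral_nonneg fun t ↦ norm_nonneg _)]
  -- `∫_{t>0} ≤ ∫_ℝ |w||Λ| ≤ (3/2) ∫ P |Λ|`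
  have hIabs : Integrable fun t : ℝ ↦ |Real.log ‖riemannZeta (σ + t * I)‖| *
      ((1 / 2 : ℝ) / ((1 / 2) ^ 2 + t ^ 2)) := by
    have h := (integrable_logZeta_mul hσ'.le hσ1 (g := fun t : ℝ ↦ (1 / 2 : ℝ) / ((1 / 2) ^ 2 + t ^ 2))
      (by fun_prop) (C := 1) (fun t ↦ by
        have h1 : (0 : ℝ) < (1 / 2) ^ 2 + t ^ 2 := by positivity
        have h2 : (0 : ℝ) < 1 / 16 + t ^ 2 := by positivity
        rw [abs_of_pos (by positivity), div_le_div_iff₀ h1 h2]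
        nlinarith [sq_nonneg t])).norm
    refine h.congr (ae_of_all _ fun t ↦ ?_)
    dsimp only
    rw [Real.norm_eq_abs, abs_mul,
      abs_of_pos (show (0 : ℝ) < (1 / 2 : ℝ) / ((1 / 2) ^ 2 + t ^ 2) by positivity)]
  have hstep1 : ∫ t : ℝ, ‖(1 - 12 * t ^ 2) / (1 + 4 * t ^ 2) ^ 3 *
      Real.log ‖riemannZeta (σ + t * I)‖‖ ∂μ ≤
      ∫ t : ℝ, ‖(1 - 12 * t ^ 2) / (1 + 4 * t ^ 2) ^ 3 * Real.log ‖riemannZeta (σ + t * I)‖‖ :=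
    setIntegral_le_integral (hline σ hσ' hσ1).norm (ae_of_all _ fun t ↦ norm_nonneg _)
  have hstep2 : ∫ t : ℝ, ‖(1 - 12 * t ^ 2) / (1 + 4 * t ^ 2) ^ 3 * Real.log ‖riemannZeta (σ + t * I)‖‖ ≤
      3 / 2 * ∫ t : ℝ, |Real.log ‖riemannZeta (σ + t * I)‖| * ((1 / 2 : ℝ) / ((1 / 2) ^ 2 + t ^ 2)) := by
    rw [← integral_const_mul]
    refine integral_mono_of_nonneg (ae_of_all _ fun t ↦ norm_nonneg _) (hIabs.const_mul _)
      (ae_of_all _ fun t ↦ ?_)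
    dsimp only
    rw [Real.norm_eq_abs, abs_mul]
    have := abs_weight_le t
    have hΛ : 0 ≤ |Real.log ‖riemannZeta (σ + t * I)‖| := abs_nonneg _
    nlinarith
  have hstep3 : ∫ t : ℝ, |Real.log ‖riemannZeta (σ + t * I)‖| * ((1 / 2 : ℝ) / ((1 / 2) ^ 2 + t ^ 2)) ≤
      K₀ * (Iic (3 : ℝ)).indicator (fun _ ↦ (1 : ℝ)) σ + 4 * Real.exp (-Real.log 2 * σ) * IP := by
    by_cases h3 : σ ≤ 3
    · rw [Set.indicator_of_mem (show σ ∈ Iic (3 : ℝ) from h3), mul_one]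
      have := hK₀ σ ⟨hσ'.le, h3⟩ hσ1
      have hexp : 0 ≤ 4 * Real.exp (-Real.log 2 * σ) * IP := by
        have : 0 ≤ IP := integral_nonneg fun t ↦ by positivity
        positivity
      linarith
    · rw [Set.indicator_of_notMem (show σ ∉ Iic (3 : ℝ) from h3), mul_zero, zero_add]
      exact poisson_abs_le_of_three_le (by linarith)
  calc _ ≤ _ := hstep1
    _ ≤ _ := hstep2
    _ ≤ 3 / 2 * (K₀ * (Iic (3 : ℝ)).indicator (fun _ ↦ (1 : ℝ)) σ +
        4 * Real.exp (-Real.log 2 * σ) * IP) := by gcongr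
    _ = B σ := by simp only [hB]

end Volchkov

/-! ### §11 Volchkov's double integral evaluated, and the criterion -/

open Volchkov in
/-- **Volchkov's double integral, evaluated unconditionally** (RH-free):
`∫₀^∞ (1−12t²)/(1+4t²)³ ∫_{1/2}^∞ log|ζ(σ+it)| dσ dt = (π/32)·(3 − γ + Σ_ρ m(ρ)·[Re ρ>1/2]·Z(ρ))`
with `Z(ρ) = β/(β²+γ²) + (1−β)/((1−β)²+γ²) − 1/(1/4+γ²) < 0` for `1/2 < β < 1` — the zero-free
value `π(3−γ)/32` is the printed right-hand side of Volchkov's equality; the order of integration is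
exchanged by Fubini (§10) and the `σ`-integrand is `integral_weight_logZeta_eq` (§7), integrated by
§8–§9. [cite: Volchkov1995, Theorem (the equality ∫∫ = π(3−γ)/32 under RH); SekatskiiBeltraminelliMerlini2012, Thm. 5a and Remark 2] -/
theorem volchkov_integral_eq :
    ∫ t in Ioi (0 : ℝ), (1 - 12 * t ^ 2) / (1 + 4 * t ^ 2) ^ 3 *
        ∫ σ in Ioi (1 / 2 : ℝ), Real.log ‖riemannZeta (σ + t * I)‖ =
      π / 32 * (3 - Real.eulerMascheroniConstant +
        ∑' ρ : ZetaZeros.riemannZetaNontrivialZeros,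
          (riemannZetaZeroOrder (ρ : ℂ) : ℝ) *
            (if 1 / 2 < (ρ : ℂ).re then
              (ρ : ℂ).re / ((ρ : ℂ).re ^ 2 + (ρ : ℂ).im ^ 2) +
                (1 - (ρ : ℂ).re) / ((1 - (ρ : ℂ).re) ^ 2 + (ρ : ℂ).im ^ 2) -
                  1 / (1 / 4 + (ρ : ℂ).im ^ 2)
            else 0)) := by
  set μ : Measure ℝ := volume.restrict (Ioi (0 : ℝ)) with hμ
  set ν : Measure ℝ := volume.restrict (Ioi (1 / 2 : ℝ)) with hν
  have hF := integrable_weight_logZeta_prod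
  -- Fubini
  have hswap := integral_integral_swap (μ := μ) (ν := ν)
    (f := fun t σ : ℝ ↦ (1 - 12 * t ^ 2) / (1 + 4 * t ^ 2) ^ 3 * Real.log ‖riemannZeta (σ + t * I)‖) hF
  have hlhs : (∫ t in Ioi (0 : ℝ), (1 - 12 * t ^ 2) / (1 + 4 * t ^ 2) ^ 3 *
        ∫ σ in Ioi (1 / 2 : ℝ), Real.log ‖riemannZeta (σ + t * I)‖) =
      ∫ t in Ioi (0 : ℝ), ∫ σ in Ioi (1 / 2 : ℝ), (1 - 12 * t ^ 2) / (1 + 4 * t ^ 2) ^ 3 *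
        Real.log ‖riemannZeta (σ + t * I)‖ := by
    congr 1
    funext t
    rw [integral_const_mul]
  rw [hlhs, hswap]
  -- the three pieces of the `σ`-integrand
  set E₁ : ℝ → ℝ := fun σ ↦ (deriv (fun z : ℂ ↦ deriv riemannZeta₁ z / riemannZeta₁ z)
    ((1 / 2 + σ : ℝ) : ℂ)).re with hE₁
  set E₂ : ℝ → ℝ := fun σ ↦ 1 / (1 / 2 + |1 - σ|) ^ 2 with hE₂
  set S₂ : ℝ → ℝ := fun σ ↦ ∑' ρ : ZetaZeros.riemannZetaNontrivialZeros,
    if σ < (ρ : ℂ).re then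
      (riemannZetaZeroOrder (ρ : ℂ) : ℝ) *
        (((ρ : ℂ).im ^ 2 - ((ρ : ℂ).re - σ + 1 / 2) ^ 2) /
            (((ρ : ℂ).re - σ + 1 / 2) ^ 2 + (ρ : ℂ).im ^ 2) ^ 2 -
          ((ρ : ℂ).im ^ 2 - ((ρ : ℂ).re - σ - 1 / 2) ^ 2) /
            (((ρ : ℂ).re - σ - 1 / 2) ^ 2 + (ρ : ℂ).im ^ 2) ^ 2)
    else 0 with hS₂
  set J : ℝ → ℝ := fun σ ↦ ∫ t in Ioi (0 : ℝ), (1 - 12 * t ^ 2) / (1 + 4 * t ^ 2) ^ 3 *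
    Real.log ‖riemannZeta (σ + t * I)‖ with hJ
  have hJint : Integrable J ν := hF.integral_prod_right
  have hae1 : ∀ᵐ σ : ℝ ∂ν, σ ≠ 1 := by
    refine ae_restrict_of_ae ?_
    rw [ae_iff]; simp
  have haeI : ∀ᵐ σ : ℝ ∂ν, σ ∈ Ioi (1 / 2 : ℝ) := ae_restrict_mem measurableSet_Ioi
  have hJ_ae : ∀ᵐ σ : ℝ ∂ν, J σ = π / 32 * (E₁ σ + E₂ σ + S₂ σ) := by
    filter_upwards [hae1, haeI] with σ hσ1 hσ
    exact integral_weight_logZeta_eq (le_of_lt hσ) hσ1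
  have hE₁int : Integrable E₁ ν := integrableOn_reDerivLogDerivZeta₁
  have hE₂int : Integrable E₂ ν := integral_elemKernel.1
  have hS₂int : Integrable S₂ ν := by
    have h := ((hJint.const_mul (32 / π)).sub hE₁int).sub hE₂int
    refine h.congr ?_
    filter_upwards [hJ_ae] with σ hσ
    simp only [Pi.sub_apply, hσ]
    have hπ : (π : ℝ) ≠ 0 := Real.pi_pos.ne'
    field_simp
    ring
  have hI : ∫ σ, J σ ∂ν = π / 32 * ((∫ σ, E₁ σ ∂ν) + (∫ σ, E₂ σ ∂ν) + ∫ σ, S₂ σ ∂ν) := by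
    rw [integral_congr_ae hJ_ae, integral_const_mul,
      integral_add (f := fun a ↦ E₁ a + E₂ a) (hE₁int.add hE₂int) hS₂int,
      integral_add hE₁int hE₂int]
  have hv1 : ∫ σ, E₁ σ ∂ν = -Real.eulerMascheroniConstant := integral_reDerivLogDerivZeta₁
  have hv2 : ∫ σ, E₂ σ ∂ν = 3 := integral_elemKernel.2
  have hv3 : ∫ σ, S₂ σ ∂ν = ∑' ρ : ZetaZeros.riemannZetaNontrivialZeros,
      (riemannZetaZeroOrder (ρ : ℂ) : ℝ) *
        (if 1 / 2 < (ρ : ℂ).re then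
          (ρ : ℂ).re / ((ρ : ℂ).re ^ 2 + (ρ : ℂ).im ^ 2) +
            (1 - (ρ : ℂ).re) / ((1 - (ρ : ℂ).re) ^ 2 + (ρ : ℂ).im ^ 2) - 1 / (1 / 4 + (ρ : ℂ).im ^ 2)
        else 0) := (hasSum_integral_zeroSum_two.tsum_eq).symm
  show ∫ σ, J σ ∂ν = _
  rw [hI, hv1, hv2, hv3]
  ring

/-- **Volchkov's criterion (DISCHARGED).** `RH ⟺ ∫₀^∞ (1−12t²)/(1+4t²)³ ∫_{1/2}^∞ log|ζ(σ+it)| dσ dt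
= π(3−γ)/32`: by `volchkov_integral_eq` the left side equals `π(3−γ)/32` plus `π/32` times a
convergent sum of NON-POSITIVE zero contributions, each strictly negative exactly for a zero with
`Re ρ > 1/2`; so equality holds iff no such zero exists, i.e. iff RH
(`riemannHypothesis_iff_forall_riemannZeta_ne_zero`). RH-EQUIVALENT bookkeeping: an equivalence,
neither side asserted; nothing here bears on the truth of RH.
[cite: Volchkov1995, Theorem (Ukr. Mat. Zh. 47 (1995) 422–423; as printed in HeJejjalaMinic2016 (2.1))] -/
theorem Volchkov1995_criterion_holds : Volchkov1995_criterion := by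
  unfold Volchkov1995_criterion
  rw [volchkov_integral_eq]
  set Z : ZetaZeros.riemannZetaNontrivialZeros → ℝ := fun ρ ↦
    (riemannZetaZeroOrder (ρ : ℂ) : ℝ) *
      (if 1 / 2 < (ρ : ℂ).re then
        (ρ : ℂ).re / ((ρ : ℂ).re ^ 2 + (ρ : ℂ).im ^ 2) +
          (1 - (ρ : ℂ).re) / ((1 - (ρ : ℂ).re) ^ 2 + (ρ : ℂ).im ^ 2) - 1 / (1 / 4 + (ρ : ℂ).im ^ 2)
      else 0) with hZ
  have hsum : Summable Z := Volchkov.hasSum_integral_zeroSum_two.summable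
  have hnonpos : ∀ ρ, Z ρ ≤ 0 := fun ρ ↦ Volchkov.zeroContribution_nonpos ρ
  constructor
  · intro hRH
    have hall : ∀ ρ : ZetaZeros.riemannZetaNontrivialZeros, ¬ (1 / 2 < (ρ : ℂ).re) := by
      intro ρ h
      exact (riemannHypothesis_iff_forall_riemannZeta_ne_zero.1 hRH (ρ : ℂ) h)
        (ZetaZeros.riemannZetaNontrivialZeros.zeta_eq_zero ρ.2)
    have h0 : ∑' ρ, Z ρ = 0 := by
      have : Z = fun _ ↦ 0 := funext fun ρ ↦ by simp only [hZ, if_neg (hall ρ), mul_zero]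
      rw [this, tsum_zero]
    show π / 32 * (3 - Real.eulerMascheroniConstant + ∑' ρ, Z ρ) =
      π * (3 - Real.eulerMascheroniConstant) / 32
    rw [h0]
    ring
  · intro heq
    have h0 : ∑' ρ, Z ρ = 0 := by
      have h1 : π / 32 * (∑' ρ, Z ρ) = 0 := by
        have heq' : π / 32 * (3 - Real.eulerMascheroniConstant + ∑' ρ, Z ρ) =
            π * (3 - Real.eulerMascheroniConstant) / 32 := heq
        linear_combination heq'
      exact (mul_eq_zero.1 h1).resolve_left (by positivity)
    have hZ0 : ∀ ρ, Z ρ = 0 := by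
      have hneg : HasSum (fun ρ ↦ -Z ρ) 0 := by simpa [h0] using hsum.hasSum.neg
      have h := (hasSum_zero_iff_of_nonneg (fun ρ ↦ neg_nonneg.2 (hnonpos ρ))).1 hneg
      intro ρ
      have := congrFun h ρ
      simpa using this
    refine riemannHypothesis_iff_forall_riemannZeta_ne_zero.2 fun s hs hζ ↦ ?_
    have hs1 : s.re < 1 := lt_of_not_ge fun h ↦ riemannZeta_ne_zero_of_one_le_re h hζ
    have hmem : s ∈ ZetaZeros.riemannZetaNontrivialZeros :=
      mem_riemannZetaNontrivialZeros_iff_holds.2 ⟨hζ, by linarith, hs1⟩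
    have hneg := Volchkov.zeroContribution_neg ⟨s, hmem⟩ hs
    have := hZ0 ⟨s, hmem⟩
    simp only [hZ] at this
    linarith

end Literature.NumberTheory.LFunctions

end
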